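import Literature.MathematicalPhysics.QuantumLattice.DWaveOrderParameterTPrimeCells
import Literature.MathematicalPhysics.QuantumLattice.DWaveSourceEnergyDensityTPPTransport
import Literature.MathematicalPhysics.QuantumLattice.HubbardTTPrimeMeanEnergySupergradient
import HarnessLib

/-!
# `d`-wave order-parameter and pair-amplitude CEILINGS over `U`-INTERVALS from TWO anchors: sourced floors
# interpolate by the CHORD (concavity in `U`, zero loss), source-free caps are the lower envelope of the two
# DOUBLE-OCCUPANCY-word TANGENTS; the bulge is second order in the cell width

Topic `Literature/MathematicalPhysics/QuantumLattice` (namespace = path; family `hubbard`). The `U`-twin of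
`DWaveOrderParameterTPrimeCells.lean` (hubbard-box-p3: `t'`-intervals from two anchors, the `K₂`-word tangents;
its §5 serves the `U`-extent of a cell only through MONOTONICITY — cap at the upper corner, floor at the lower
corner — i.e. at the price `E(U₂,0) − E(U₁,h)`, FIRST order in the cell width with the double occupancy as the
constant), written from the `U`-direction lane of the downfolding cell (`pub/hubbard-downfold`, seat
hubbard-downfold-unc-1: «monotonicity / Lipschitz / tangent transport in `U` so a parameter BOX maps to a certified
word»). Motivation of record: on a downfolded one-band material box the `U/t`-extent is several units of `t`
(`Downfold.la214M_M15_orderSeam_cost_le`: the single-anchor order seam of `pub/hubbard-downfold` mod-1 costs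
`≤ 4.714`, of which `3.7 = (U/t half-width)·1` is the `U`-term), so the ORDER word is the one word whose
`U`-transport is vacuous at first order.

Objects (all in the tree): `E(s,U,μ,h) := dWaveSourceEnergyDensityTT' s U μ h` (thermodynamic-limit ground-state
energy density of the `d`-wave pair-sourced grand-canonical `t–t'` Hubbard torus at `t = 1`; JOINTLY CONCAVE in
`(s,U,μ,h)`, non-decreasing and `1`-Lipschitz in `U`), `m⋆(s,U,μ) := dWaveOrderParameterTT' s U μ` (Koma–Tasaki
order parameter, `≤ (E(·,0) − E(·,h))/(2h)` for every `h > 0`), `D(ω) := ω.meanEnergy (hubbardTTPrimeFermionInteraction 0 0 1) 1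
= Re ω(n_{0↑}n_{0↓})` (double-occupancy density), `e(t,s,U,n) := energyDensityTT' t s U n` (canonical density,
concave and non-decreasing in `U ≥ 0`).

* §1 TANGENT IN `U` at a translation-invariant sourced ground state (minimiser form):
  `E(s,U',μ,h) ≤ E(s,U,μ,h) + (U' − U)·D(ω)`; `0 ≤ D ≤ 1` recovers the tree's monotone / `1`-Lipschitz laws.
* §2 TWO-ANCHOR `U`-INTERVAL FLOORS (concavity, ZERO loss): floors `loᵢ ≤ E(s,Uᵢ,μ,h)` give the CHORD
  `lo₁ + (lo₂ − lo₁)(U − U₁)/(U₂ − U₁) ≤ E(s,U,μ,h)` on `[U₁,U₂]` (and `max(lo₁, chord)` by monotonicity).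
* §3 `U`-INTERVAL CAPS from DOUBLE-OCCUPANCY WORDS. (a) Grand-canonical words: if every translation-invariant sourced
  ground state at `U₁` has `D ≤ A` and every one at `U₂` has `D ≥ B`, then
  `E(U) ≤ min(hi₁ + A(U − U₁), hi₂ − B(U₂ − U))`; one-anchor half-rays (`hi₀ + (U − U₀)A` to the right,
  `hi₀ − (U₀ − U)B` to the left). (b) CANONICAL words — the certificate format of record (`∀` torus limits of unit
  `(rectN n L, S^z = 0)`-sector ground states of `hubbardTorusTT' L t s Uᵢ`, `Re ω(n_{0↑}n_{0↓}) ≤ A` / `≥ B`, the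
  registry's docc rows #257/#261 …): `e(t,s,U,n) ≤ min(R₁ + A(U − U₁), R₂ − B(U₂ − U))` on `[U₁,U₂]` (the two-anchor
  sharpening of hubbard-fast's one-anchor `energyDensityTT'_le_of_forall_isTorusLimitOf_docc`; kinematic edition
  `A = n/2`, `B = 0`), hence by Legendre `E(s,U,μ,h) ≤ min(…) − μn`.
* §4 **ORDER CEILINGS ON A WHOLE `U`-INTERVAL from the two anchors**: for `U ∈ [U₁,U₂]`, `h > 0`,
  `m⋆(s,U,μ) ≤ (min(hi₁ + A(U − U₁), hi₂ − B(U₂ − U)) − chord(lo₁,lo₂;U))/(2h)` (grand-canonical words at `h = 0`;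
  canonical edition with `Rᵢ − μn`; kinematic canonical edition), and the UNIFORM BULGE form
  `m⋆ ≤ (max g₁ g₂ + (U₂ − U₁)·α⁺β⁺/(α⁺ + β⁺))/(2h)`, `gᵢ = hiᵢ − loᵢ` the two anchor gaps,
  `α = A − σ`, `β = σ − B`, `σ = (lo₂ − lo₁)/(U₂ − U₁)` the certified secant slope of the sourced floors
  (the fast cell's `le_max_add_bulge_of_le_two_affine`): the excess over the anchor gaps is governed by how far the
  certified docc ceiling at the left end / floor at the right end sit from the certified secant slope — SECOND
  ORDER in the width for docc windows of second-order width, never worse than `(U₂ − U₁)·min(α⁺,β⁺)`; one-anchor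
  RIGHT half-ray `m⋆(s,U,μ) ≤ (hi₀ − lo₀ + (U − U₀)·A)/(2h)` (slope `1 → A` versus
  `dWaveOrderParameterTT'_le_of_windows_U_box`); ABSENT(`< m₀`) on the whole interval.
* §5 `[U₁,U₂] × [μ₁,μ₂]` CELLS (caps read at `μ₁`, floors at `μ₂`: `E` is non-increasing in `μ`, the canonical
  Legendre cap `− μn ≤ − μ₁n`).
* §6 THE NEAR-MINIMISER PAIR-AMPLITUDE CURRENCY of the downfold seam (`DWaveSourceEnergyDensityTPPTransport` §4 /
  `Downfold.TppSeamOrder`): for every translation-invariant `ε`-near-minimiser `σ` of source-free object M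
  `(1, t', t'', U, μ')` with `U ∈ [U₁,U₂]`,
  `e_P(σ) ≤ (N(U) + (32/π²)|t' − s| + 2|μ' − μ| + (32/π²)|t''| + ε)/h`, `N(U)` the §4 numerator (or its bulge
  bound) — the drop-in replacement of `meanEnergy_pairSource_le_of_windows_couplings4` with the `U`-term
  `|U − U₀|·1` replaced by the two-anchor bulge and the `t'`-constant `8` by `32/π²`.
* §7 BY-PRODUCT FOR THE ENERGY WORD: the POINTWISE canonical window on a `U`-cell from the two anchors and their docc
  rows, `e(t,s,U,n) ∈ [chord(L₁,L₂;U), min(R₁ + A(U − U₁), R₂ − B(U₂ − U))]`, and the UNIFORM word on a query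
  sub-interval `[a,b] ⊆ [U₁,U₂]`: `[min(chord(a),chord(b)), min(R₁ + A(b − U₁), R₂ − B(U₂ − b))]` (the monotone cell
  word `[L₁, R₂]` of `HubbardTTPrimeUBoxWords` §1 read at the resolution of the query box).
* §8 ROW-FREE CHAIN EDITION: on a chain of anchors `U₀ < U₁ < U₂ < U₃` carrying canonical ENERGY windows only, the
  secant slopes of the neighbouring cells ARE admissible docc words for the cell `[U₁,U₂]`
  (`A = (R₁ − L₀)/(U₁ − U₀)` at `U₁`, `B = (L₃ − R₂)/(U₃ − U₂)` at `U₂`; the tree's `U`-chord docc rows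
  `IsTorusLimitOf.re_expect_docc_le_chord_of_groundState` / `chord_le_re_expect_docc_of_groundState`), so every
  docc-word theorem above runs on the energy table of a `U`-cover alone (interior cells need no docc row).

HONEST SCOPE: ceiling-side (ABSENT-side) bookkeeping; nothing here floors `d`-wave order; every number a consumer
gets is conditional on the anchor certificates (two object-E pairs and two docc words per `U`-cell) it feeds in;
the docc words the sharp forms consume are the SOURCE-FREE rows the registry already produces. Everything is PROVED;
no definition, no named fact, zero compute, no `sorry`.

## References
* R. B. Griffiths, J. Math. Phys. 5 (1964) 1215, §II (secant / chord bounds for concave thermodynamic functions).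
  [cite: Griffiths1964, §II]
* R. B. Israel, *Convexity in the Theory of Lattice Gases* (1979), Thm. I.3.4 (concavity and Lipschitz continuity of
  the thermodynamic functional in the interaction; tangent functionals at a minimiser). [cite: Israel1979, Thm. I.3.4]
* T. Koma, H. Tasaki, J. Stat. Phys. 76 (1994) 745–803, §1 (the quasi-average order parameter and its secant bound).
  [cite: KomaTasaki1994, §1]
* D. Ruelle, *Statistical Mechanics: Rigorous Results* (1969), §3.4 (Legendre duality canonical / grand canonical).
  [cite: Ruelle1969, §3.4]
* A. Neumaier, *Complete search in continuous global optimization*, Acta Numerica 13 (2004), §11 (lower envelope of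
  two affine majorants). [cite: Neumaier2004CompleteSearch, §11]
-/

noncomputable section

namespace Literature.MathematicalPhysics.QuantumLattice

open _root_.Matrix Finset Set HubbardWave0 Literature.Probability.LatticeModels ThermodynamicLimit _root_.Filter
open scoped _root_.Topology

/-! ### §1 Tangent in `U` at a translation-invariant sourced ground state -/

section Tangent

/-- **Tangent in `U` at a translation-invariant state attaining the sourced minimum**: if `ω` is translation
invariant with `Re ω(E^src_{s,U,μ,h}) = E(s,U,μ,h)` then `E(s,U',μ,h) ≤ E(s,U,μ,h) + (U' − U)·D(ω)` for every real
`U'` (`ω` is a trial state at `U'`; the mean energy is affine in `U` with slope `D`). [cite: Israel1979, Thm. I.3.4] -/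
theorem dWaveSourceEnergyDensityTT'_le_add_mul_docc_of_minimiser {s U μ h : ℝ} {ω : InfVolFermionState 2}
    (hω : ω.IsTranslationInvariant)
    (hωe : (ω.expect dWaveSourceWindow (dWaveSourceEnergyObsTT' s U μ h)).re = dWaveSourceEnergyDensityTT' s U μ h)
    (U' : ℝ) :
    dWaveSourceEnergyDensityTT' s U' μ h ≤
      dWaveSourceEnergyDensityTT' s U μ h + (U' - U) * ω.meanEnergy (hubbardTTPrimeFermionInteraction 0 0 1) 1 := by
  have hvar := dWaveSourceEnergyDensityTT'_le_re_expect s U' μ h ω hω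
  rw [ω.re_expect_dWaveSourceEnergyObsTT' s U' μ h, InfVolFermionState.meanEnergy_hubbardTTPrimeSourced,
    ω.meanEnergy_hubbardTTPrime_affine 1 s U s U', sub_self, zero_mul, add_zero] at hvar
  rw [ω.re_expect_dWaveSourceEnergyObsTT' s U μ h, InfVolFermionState.meanEnergy_hubbardTTPrimeSourced] at hωe
  linarith

/-- **Tangent in `U` at a sourced ground state, minimiser form**: if `ω` minimises the mean energy of the sourced
interaction at `(s,U,μ,h)` among translation-invariant states then `E(s,U',μ,h) ≤ E(s,U,μ,h) + (U' − U)·D(ω)` for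
every real `U'`. [cite: Israel1979, Thm. I.3.4] -/
theorem InfVolFermionState.IsMeanEnergyMinimiser.dWaveSourceEnergyDensityTT'_le_add_mul_docc {s U μ h : ℝ}
    {ω : InfVolFermionState 2}
    (hω : ω.IsMeanEnergyMinimiser (hubbardTTPrimeSourcedInteraction 1 s U μ dWaveFormFactor h) 1) (U' : ℝ) :
    dWaveSourceEnergyDensityTT' s U' μ h ≤
      dWaveSourceEnergyDensityTT' s U μ h + (U' - U) * ω.meanEnergy (hubbardTTPrimeFermionInteraction 0 0 1) 1 := by
  have hωe : (ω.expect dWaveSourceWindow (dWaveSourceEnergyObsTT' s U μ h)).re = dWaveSourceEnergyDensityTT' s U μ h := by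
    rw [ω.re_expect_dWaveSourceEnergyObsTT' s U μ h, hω.meanEnergy_eq,
      dWaveSourceEnergyDensityTT'_eq_tiGroundEnergyDensity]
  exact dWaveSourceEnergyDensityTT'_le_add_mul_docc_of_minimiser hω.1 hωe U'

/-- **The slope lies in `[0, 1]`**: `0 ≤ D(ω) ≤ 1` for every state (the monotone / `1`-Lipschitz laws of
`DWaveSourceEnergyDensityCouplingTransport` §3 are the two kinematic readings of §1). [cite: Ruelle1969, §3.4] -/
theorem InfVolFermionState.meanEnergy_hubbardTTPrime_onSite_mem_Icc_zero_one (ω : InfVolFermionState 2) :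
    ω.meanEnergy (hubbardTTPrimeFermionInteraction 0 0 1) 1 ∈ Set.Icc (0 : ℝ) 1 := by
  refine ⟨ω.meanEnergy_hubbardTTPrime_onSite_nonneg, ?_⟩
  rw [ω.meanEnergy_hubbardTTPrime_onSite_eq_re_expect_docc]
  exact ω.re_expect_docc_le_one

end Tangent

/-! ### §2 Two-anchor `U`-interval FLOORS (concavity in `U`; zero loss) -/

section Floors

/-- Barycentric floor along `U` at fixed `(s, μ, h)`: convex weights `p, q` with `p U₁ + q U₂ = U` and floors
`loᵢ ≤ E(s,Uᵢ,μ,h)` give `p lo₁ + q lo₂ ≤ E(s,U,μ,h)`. [cite: Griffiths1964, §II] -/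
theorem dWaveSourceEnergyDensityTT'_convexComb_U_ge {s U₁ U₂ U μ h lo₁ lo₂ p q : ℝ} (hp : 0 ≤ p) (hq : 0 ≤ q)
    (hpq : p + q = 1) (hU : p * U₁ + q * U₂ = U)
    (hlo₁ : lo₁ ≤ dWaveSourceEnergyDensityTT' s U₁ μ h) (hlo₂ : lo₂ ≤ dWaveSourceEnergyDensityTT' s U₂ μ h) :
    p * lo₁ + q * lo₂ ≤ dWaveSourceEnergyDensityTT' s U μ h := by
  have key := dWaveSourceEnergyDensityTT'_convexComb_couplings_ge (tp₁ := s) (U₁ := U₁) (μ₁ := μ) (h₁ := h)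
    (tp₂ := s) (U₂ := U₂) (μ₂ := μ) (h₂ := h) hp hq hpq
  have hs : p * s + q * s = s := by rw [← add_mul, hpq, one_mul]
  have hμ : p * μ + q * μ = μ := by rw [← add_mul, hpq, one_mul]
  have hh : p * h + q * h = h := by rw [← add_mul, hpq, one_mul]
  rw [hs, hU, hμ, hh] at key
  nlinarith [mul_le_mul_of_nonneg_left hlo₁ hp, mul_le_mul_of_nonneg_left hlo₂ hq]

/-- **CHORD FLOOR between two `U`-anchors (zero loss)**: for `U₁ < U₂`, `U ∈ [U₁,U₂]`, floors
`loᵢ ≤ E(s,Uᵢ,μ,h)` give `lo₁ + (lo₂ − lo₁)(U − U₁)/(U₂ − U₁) ≤ E(s,U,μ,h)` — `E` is concave in `U`.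
[cite: Griffiths1964, §II] -/
theorem dWaveSourceEnergyDensityTT'_ge_U_chord {s U₁ U₂ U μ h lo₁ lo₂ : ℝ} (hlt : U₁ < U₂) (h₁ : U₁ ≤ U)
    (h₂ : U ≤ U₂) (hlo₁ : lo₁ ≤ dWaveSourceEnergyDensityTT' s U₁ μ h)
    (hlo₂ : lo₂ ≤ dWaveSourceEnergyDensityTT' s U₂ μ h) :
    lo₁ + (lo₂ - lo₁) * (U - U₁) / (U₂ - U₁) ≤ dWaveSourceEnergyDensityTT' s U μ h := by
  have hd : 0 < U₂ - U₁ := sub_pos.2 hlt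
  have hp : 0 ≤ (U₂ - U) / (U₂ - U₁) := div_nonneg (sub_nonneg.2 h₂) hd.le
  have hq : 0 ≤ (U - U₁) / (U₂ - U₁) := div_nonneg (sub_nonneg.2 h₁) hd.le
  have hpq : (U₂ - U) / (U₂ - U₁) + (U - U₁) / (U₂ - U₁) = 1 := by
    rw [← add_div, show U₂ - U + (U - U₁) = U₂ - U₁ by ring, div_self hd.ne']
  have hU : (U₂ - U) / (U₂ - U₁) * U₁ + (U - U₁) / (U₂ - U₁) * U₂ = U := by
    rw [div_mul_eq_mul_div, div_mul_eq_mul_div, ← add_div, div_eq_iff hd.ne']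
    ring
  have key := dWaveSourceEnergyDensityTT'_convexComb_U_ge hp hq hpq hU hlo₁ hlo₂
  have e : lo₁ + (lo₂ - lo₁) * (U - U₁) / (U₂ - U₁) =
      (U₂ - U) / (U₂ - U₁) * lo₁ + (U - U₁) / (U₂ - U₁) * lo₂ := by
    field_simp
    ring
  rw [e]
  exact key

/-- **Monotone + chord floor**: under the same hypotheses `max lo₁ (chord) ≤ E(s,U,μ,h)` on `[U₁,U₂]` (the floor at
the LEFT anchor serves every `U ≥ U₁` for free, `E` being non-decreasing in `U`; useful when the certified
numbers happen to satisfy `lo₂ < lo₁`). [cite: Griffiths1964, §II] -/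
theorem dWaveSourceEnergyDensityTT'_U_interval_ge_max {s U₁ U₂ U μ h lo₁ lo₂ : ℝ} (hlt : U₁ < U₂) (h₁ : U₁ ≤ U)
    (h₂ : U ≤ U₂) (hlo₁ : lo₁ ≤ dWaveSourceEnergyDensityTT' s U₁ μ h)
    (hlo₂ : lo₂ ≤ dWaveSourceEnergyDensityTT' s U₂ μ h) :
    max lo₁ (lo₁ + (lo₂ - lo₁) * (U - U₁) / (U₂ - U₁)) ≤ dWaveSourceEnergyDensityTT' s U μ h :=
  max_le (dWaveSourceEnergyDensityTT'_ge_of_ge_at_smaller_U s μ h h₁ hlo₁)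
    (dWaveSourceEnergyDensityTT'_ge_U_chord hlt h₁ h₂ hlo₁ hlo₂)

end Floors

/-! ### §3 `U`-interval CAPS from double-occupancy words -/

section CapsGC

/-- **One anchor, target to the RIGHT, docc CEILING word** (grand-canonical class): a cap `E(s,U₀,μ,h) ≤ hi₀` and
«every translation-invariant sourced ground state at `(s,U₀,μ,h)` has `D ≤ A`» give `E(s,U,μ,h) ≤ hi₀ + (U − U₀)·A`
for every `U ≥ U₀` (slope `1 → A`). [cite: Israel1979, Thm. I.3.4] -/
theorem dWaveSourceEnergyDensityTT'_le_anchorCap_add_mul_of_doccWord {s U₀ μ h hi₀ A : ℝ}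
    (hhi : dWaveSourceEnergyDensityTT' s U₀ μ h ≤ hi₀)
    (hA : ∀ ω : InfVolFermionState 2,
      ω.IsMeanEnergyMinimiser (hubbardTTPrimeSourcedInteraction 1 s U₀ μ dWaveFormFactor h) 1 →
        ω.meanEnergy (hubbardTTPrimeFermionInteraction 0 0 1) 1 ≤ A)
    {U : ℝ} (hU : U₀ ≤ U) : dWaveSourceEnergyDensityTT' s U μ h ≤ hi₀ + (U - U₀) * A := by
  obtain ⟨ω₀, hω₀⟩ := (hubbardTTPrimeSourcedInteraction 1 s U₀ μ dWaveFormFactor h).exists_isMeanEnergyMinimiser 1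
  have t0 := hω₀.dWaveSourceEnergyDensityTT'_le_add_mul_docc U
  nlinarith [mul_le_mul_of_nonneg_left (hA ω₀ hω₀) (sub_nonneg.2 hU)]

/-- **One anchor, target to the LEFT, docc FLOOR word**: a cap `E(s,U₀,μ,h) ≤ hi₀` and «every translation-invariant
sourced ground state at `(s,U₀,μ,h)` has `D ≥ B`» give `E(s,U,μ,h) ≤ hi₀ − (U₀ − U)·B` for every `U ≤ U₀` (versus
the free monotone cap `hi₀`). [cite: Israel1979, Thm. I.3.4] -/
theorem dWaveSourceEnergyDensityTT'_le_anchorCap_sub_mul_of_doccWord {s U₀ μ h hi₀ B : ℝ}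
    (hhi : dWaveSourceEnergyDensityTT' s U₀ μ h ≤ hi₀)
    (hB : ∀ ω : InfVolFermionState 2,
      ω.IsMeanEnergyMinimiser (hubbardTTPrimeSourcedInteraction 1 s U₀ μ dWaveFormFactor h) 1 →
        B ≤ ω.meanEnergy (hubbardTTPrimeFermionInteraction 0 0 1) 1)
    {U : ℝ} (hU : U ≤ U₀) : dWaveSourceEnergyDensityTT' s U μ h ≤ hi₀ - (U₀ - U) * B := by
  obtain ⟨ω₀, hω₀⟩ := (hubbardTTPrimeSourcedInteraction 1 s U₀ μ dWaveFormFactor h).exists_isMeanEnergyMinimiser 1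
  have t0 := hω₀.dWaveSourceEnergyDensityTT'_le_add_mul_docc U
  nlinarith [mul_le_mul_of_nonneg_left (hB ω₀ hω₀) (sub_nonneg.2 hU)]

/-- **TWO TANGENT MAJORANTS from docc WORDS on the sourced ground states**: if every translation-invariant
mean-energy minimiser of the sourced interaction at `(s,U₁,μ,h)` has `D ≤ A` and every one at `(s,U₂,μ,h)` has
`D ≥ B`, then for `U ∈ [U₁,U₂]`: `E(s,U,μ,h) ≤ min(hi₁ + A(U − U₁), hi₂ − B(U₂ − U))`. [cite: Israel1979, Thm. I.3.4] -/
theorem dWaveSourceEnergyDensityTT'_le_min_tangents_of_doccWords {s U₁ U₂ U μ h hi₁ hi₂ A B : ℝ}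
    (h₁ : U₁ ≤ U) (h₂ : U ≤ U₂) (hhi₁ : dWaveSourceEnergyDensityTT' s U₁ μ h ≤ hi₁)
    (hhi₂ : dWaveSourceEnergyDensityTT' s U₂ μ h ≤ hi₂)
    (hA : ∀ ω : InfVolFermionState 2,
      ω.IsMeanEnergyMinimiser (hubbardTTPrimeSourcedInteraction 1 s U₁ μ dWaveFormFactor h) 1 →
        ω.meanEnergy (hubbardTTPrimeFermionInteraction 0 0 1) 1 ≤ A)
    (hB : ∀ ω : InfVolFermionState 2,
      ω.IsMeanEnergyMinimiser (hubbardTTPrimeSourcedInteraction 1 s U₂ μ dWaveFormFactor h) 1 →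
        B ≤ ω.meanEnergy (hubbardTTPrimeFermionInteraction 0 0 1) 1) :
    dWaveSourceEnergyDensityTT' s U μ h ≤ min (hi₁ + A * (U - U₁)) (hi₂ - B * (U₂ - U)) := by
  refine le_min ?_ ?_
  · have := dWaveSourceEnergyDensityTT'_le_anchorCap_add_mul_of_doccWord hhi₁ hA h₁
    linarith
  · have := dWaveSourceEnergyDensityTT'_le_anchorCap_sub_mul_of_doccWord hhi₂ hB h₂
    linarith

end CapsGC

section CapsCanonical

/-- **Canonical one-anchor cap to the RIGHT with a docc CEILING word** (the certificate format of record: every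
torus limit of unit `(rectN n L, S^z = 0)`-sector ground states of `hubbardTorusTT' L t s U₀` has
`Re ω(n_{0↑}n_{0↓}) ≤ A`): a canonical cap `e(t,s,U₀,n) ≤ R` gives `e(t,s,U,n) ≤ R + (U − U₀)·A` for every
`U ≥ U₀` (`U₀ ≥ 0`, `0 ≤ n < 2`; one torus-limit ground state exists and is a trial state at `U`).
[cite: KomaTasaki1994, §1] -/
theorem energyDensityTT'_le_cap_add_mul_of_forall_isTorusLimitOf_docc_le (t s : ℝ) {U₀ : ℝ} (hU₀ : 0 ≤ U₀)
    {n : ℝ} (hn0 : 0 ≤ n) (hn2 : n < 2) {R A : ℝ} (hR : energyDensityTT' t s U₀ n ≤ R)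
    (hA : ∀ (ω : InfVolFermionState 2) (Ls : ℕ → ℕ) (ψ : ∀ L, Fock (Orb (FermionTorus 2 L))),
      Tendsto Ls atTop atTop →
      (∀ j, IsGroundStateInSector (hubbardTorusTT' (Ls j) t s U₀) (rectN n (Ls j)) 0 (ψ (Ls j))) →
      (∀ j, star (ψ (Ls j)) ⬝ᵥ ψ (Ls j) = 1) → ω.IsTorusLimitOf ψ Ls →
      (ω.expect ({0} : Finset (Site 2))
          (nAt 0 (Finset.mem_singleton_self 0) 0 * nAt 0 (Finset.mem_singleton_self 0) 1)).re ≤ A)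
    {U : ℝ} (hU : U₀ ≤ U) : energyDensityTT' t s U n ≤ R + (U - U₀) * A := by
  obtain ⟨ψ, Ls, ω, hLs, hω, -, -, h1, hψ, -, -, -⟩ :=
    exists_isTorusLimitOf_squareGroundStatesTT'_meanEnergy_eq t s hU₀ hn0 hn2
  have ha := hA ω Ls ψ hLs hψ h1 hω
  have hb := hω.energyDensityTT'_sub_le_mul_re_expect_docc t s hU₀ hn0 hn2 hLs hψ h1 (hU₀.trans hU)
  nlinarith [mul_le_mul_of_nonneg_left ha (sub_nonneg.2 hU)]

/-- **Canonical one-anchor cap to the LEFT with a docc FLOOR word** (every torus-limit ground state at the anchor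
has `B ≤ Re ω(n_{0↑}n_{0↓})`): `e(t,s,U₀,n) ≤ R` gives `e(t,s,U,n) ≤ R − (U₀ − U)·B` for `0 ≤ U ≤ U₀` (versus the
free monotone cap `R`). [cite: KomaTasaki1994, §1] -/
theorem energyDensityTT'_le_cap_sub_mul_of_forall_isTorusLimitOf_le_docc (t s : ℝ) {U₀ : ℝ} (hU₀ : 0 ≤ U₀)
    {n : ℝ} (hn0 : 0 ≤ n) (hn2 : n < 2) {R B : ℝ} (hR : energyDensityTT' t s U₀ n ≤ R)
    (hB : ∀ (ω : InfVolFermionState 2) (Ls : ℕ → ℕ) (ψ : ∀ L, Fock (Orb (FermionTorus 2 L))),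
      Tendsto Ls atTop atTop →
      (∀ j, IsGroundStateInSector (hubbardTorusTT' (Ls j) t s U₀) (rectN n (Ls j)) 0 (ψ (Ls j))) →
      (∀ j, star (ψ (Ls j)) ⬝ᵥ ψ (Ls j) = 1) → ω.IsTorusLimitOf ψ Ls →
      B ≤ (ω.expect ({0} : Finset (Site 2))
          (nAt 0 (Finset.mem_singleton_self 0) 0 * nAt 0 (Finset.mem_singleton_self 0) 1)).re)
    {U : ℝ} (hU0 : 0 ≤ U) (hU : U ≤ U₀) : energyDensityTT' t s U n ≤ R - (U₀ - U) * B := by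
  obtain ⟨ψ, Ls, ω, hLs, hω, -, -, h1, hψ, -, -, -⟩ :=
    exists_isTorusLimitOf_squareGroundStatesTT'_meanEnergy_eq t s hU₀ hn0 hn2
  have hb0 := hB ω Ls ψ hLs hψ h1 hω
  have hb := hω.energyDensityTT'_sub_le_mul_re_expect_docc t s hU₀ hn0 hn2 hLs hψ h1 hU0
  nlinarith [mul_le_mul_of_nonneg_left hb0 (sub_nonneg.2 hU)]

/-- **CANONICAL `U`-INTERVAL CAP from the two docc words**: caps `e(t,s,Uᵢ,n) ≤ Rᵢ` (`0 ≤ U₁`, `0 ≤ n < 2`), a docc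
CEILING word `A` on the torus-limit ground states at `U₁` and a docc FLOOR word `B` at `U₂` give
`e(t,s,U,n) ≤ min(R₁ + A(U − U₁), R₂ − B(U₂ − U))` for every `U ∈ [U₁,U₂]` — the lower envelope of the two tangents,
below the one-anchor tangent and below the monotone cap `R₂`. [cite: KomaTasaki1994, §1] -/
theorem energyDensityTT'_U_interval_le_min_tangents_of_doccWords (t s : ℝ) {U₁ U₂ U : ℝ} (hU₁ : 0 ≤ U₁)
    (h₁ : U₁ ≤ U) (h₂ : U ≤ U₂) {n : ℝ} (hn0 : 0 ≤ n) (hn2 : n < 2) {R₁ R₂ A B : ℝ}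
    (hR₁ : energyDensityTT' t s U₁ n ≤ R₁) (hR₂ : energyDensityTT' t s U₂ n ≤ R₂)
    (hA : ∀ (ω : InfVolFermionState 2) (Ls : ℕ → ℕ) (ψ : ∀ L, Fock (Orb (FermionTorus 2 L))),
      Tendsto Ls atTop atTop →
      (∀ j, IsGroundStateInSector (hubbardTorusTT' (Ls j) t s U₁) (rectN n (Ls j)) 0 (ψ (Ls j))) →
      (∀ j, star (ψ (Ls j)) ⬝ᵥ ψ (Ls j) = 1) → ω.IsTorusLimitOf ψ Ls →
      (ω.expect ({0} : Finset (Site 2))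
          (nAt 0 (Finset.mem_singleton_self 0) 0 * nAt 0 (Finset.mem_singleton_self 0) 1)).re ≤ A)
    (hB : ∀ (ω : InfVolFermionState 2) (Ls : ℕ → ℕ) (ψ : ∀ L, Fock (Orb (FermionTorus 2 L))),
      Tendsto Ls atTop atTop →
      (∀ j, IsGroundStateInSector (hubbardTorusTT' (Ls j) t s U₂) (rectN n (Ls j)) 0 (ψ (Ls j))) →
      (∀ j, star (ψ (Ls j)) ⬝ᵥ ψ (Ls j) = 1) → ω.IsTorusLimitOf ψ Ls →
      B ≤ (ω.expect ({0} : Finset (Site 2))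
          (nAt 0 (Finset.mem_singleton_self 0) 0 * nAt 0 (Finset.mem_singleton_self 0) 1)).re) :
    energyDensityTT' t s U n ≤ min (R₁ + A * (U - U₁)) (R₂ - B * (U₂ - U)) := by
  refine le_min ?_ ?_
  · have := energyDensityTT'_le_cap_add_mul_of_forall_isTorusLimitOf_docc_le t s hU₁ hn0 hn2 hR₁ hA h₁
    linarith
  · have := energyDensityTT'_le_cap_sub_mul_of_forall_isTorusLimitOf_le_docc t s (hU₁.trans (h₁.trans h₂))
      hn0 hn2 hR₂ hB (hU₁.trans h₁) h₂
    linarith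

/-- **Kinematic canonical `U`-interval cap** (no docc word: `0 ≤ Re ω(n_{0↑}n_{0↓}) ≤ n/2` on the torus-limit
ground states): `e(t,s,U,n) ≤ min(R₁ + (n/2)(U − U₁), R₂)` on `[U₁,U₂]`. [cite: Ruelle1969, §3.4] -/
theorem energyDensityTT'_U_interval_le_min_kinematic (t s : ℝ) {U₁ U₂ U : ℝ} (hU₁ : 0 ≤ U₁) (h₁ : U₁ ≤ U)
    (h₂ : U ≤ U₂) {n : ℝ} (hn0 : 0 ≤ n) (hn2 : n < 2) {R₁ R₂ : ℝ} (hR₁ : energyDensityTT' t s U₁ n ≤ R₁)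
    (hR₂ : energyDensityTT' t s U₂ n ≤ R₂) :
    energyDensityTT' t s U n ≤ min (R₁ + n / 2 * (U - U₁)) R₂ := by
  have hA : ∀ (ω : InfVolFermionState 2) (Ls : ℕ → ℕ) (ψ : ∀ L, Fock (Orb (FermionTorus 2 L))),
      Tendsto Ls atTop atTop →
      (∀ j, IsGroundStateInSector (hubbardTorusTT' (Ls j) t s U₁) (rectN n (Ls j)) 0 (ψ (Ls j))) →
      (∀ j, star (ψ (Ls j)) ⬝ᵥ ψ (Ls j) = 1) → ω.IsTorusLimitOf ψ Ls →
      (ω.expect ({0} : Finset (Site 2))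
          (nAt 0 (Finset.mem_singleton_self 0) 0 * nAt 0 (Finset.mem_singleton_self 0) 1)).re ≤ n / 2 := by
    intro ω Ls ψ hLs hψ h1 hω
    have hN : ∀ j, IsNParticle (rectN n (Ls j)) (ψ (Ls j)) := fun j => ((mem_szSector_iff _ _ _).1 (hψ j).1).1
    rw [← hω.meanEnergy_onSite_eq_re_expect_docc hLs]
    exact hω.docc_le_half_density hn0 hLs hN h1
  have hB : ∀ (ω : InfVolFermionState 2) (Ls : ℕ → ℕ) (ψ : ∀ L, Fock (Orb (FermionTorus 2 L))),
      Tendsto Ls atTop atTop →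
      (∀ j, IsGroundStateInSector (hubbardTorusTT' (Ls j) t s U₂) (rectN n (Ls j)) 0 (ψ (Ls j))) →
      (∀ j, star (ψ (Ls j)) ⬝ᵥ ψ (Ls j) = 1) → ω.IsTorusLimitOf ψ Ls →
      0 ≤ (ω.expect ({0} : Finset (Site 2))
          (nAt 0 (Finset.mem_singleton_self 0) 0 * nAt 0 (Finset.mem_singleton_self 0) 1)).re :=
    fun ω _ _ _ _ _ _ => ω.re_expect_docc_nonneg
  have key := energyDensityTT'_U_interval_le_min_tangents_of_doccWords t s hU₁ h₁ h₂ hn0 hn2 hR₁ hR₂ hA hB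
  rwa [zero_mul, sub_zero] at key

/-- **Sourced `U`-interval cap THROUGH THE CANONICAL docc words** (Legendre: `E(s,U,μ,h) ≤ e(1,s,U,n) − μn` for every
filling `n`): canonical caps `e(1,s,Uᵢ,n) ≤ Rᵢ`, a docc ceiling word `A` at `U₁` and a docc floor word `B` at `U₂`
(torus-limit ground states of the source-free canonical model at `t = 1`) cap the sourced density at every chemical
potential and every source: `E(s,U,μ,h) ≤ min(R₁ + A(U − U₁), R₂ − B(U₂ − U)) − μn` on `[U₁,U₂]`.
[cite: Ruelle1969, §3.4] -/
theorem dWaveSourceEnergyDensityTT'_U_interval_le_of_canonical_doccWords (s : ℝ) {U₁ U₂ U : ℝ} (hU₁ : 0 ≤ U₁)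
    (h₁ : U₁ ≤ U) (h₂ : U ≤ U₂) {n : ℝ} (hn0 : 0 ≤ n) (hn2 : n < 2) (μ h : ℝ) {R₁ R₂ A B : ℝ}
    (hR₁ : energyDensityTT' 1 s U₁ n ≤ R₁) (hR₂ : energyDensityTT' 1 s U₂ n ≤ R₂)
    (hA : ∀ (ω : InfVolFermionState 2) (Ls : ℕ → ℕ) (ψ : ∀ L, Fock (Orb (FermionTorus 2 L))),
      Tendsto Ls atTop atTop →
      (∀ j, IsGroundStateInSector (hubbardTorusTT' (Ls j) 1 s U₁) (rectN n (Ls j)) 0 (ψ (Ls j))) →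
      (∀ j, star (ψ (Ls j)) ⬝ᵥ ψ (Ls j) = 1) → ω.IsTorusLimitOf ψ Ls →
      (ω.expect ({0} : Finset (Site 2))
          (nAt 0 (Finset.mem_singleton_self 0) 0 * nAt 0 (Finset.mem_singleton_self 0) 1)).re ≤ A)
    (hB : ∀ (ω : InfVolFermionState 2) (Ls : ℕ → ℕ) (ψ : ∀ L, Fock (Orb (FermionTorus 2 L))),
      Tendsto Ls atTop atTop →
      (∀ j, IsGroundStateInSector (hubbardTorusTT' (Ls j) 1 s U₂) (rectN n (Ls j)) 0 (ψ (Ls j))) →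
      (∀ j, star (ψ (Ls j)) ⬝ᵥ ψ (Ls j) = 1) → ω.IsTorusLimitOf ψ Ls →
      B ≤ (ω.expect ({0} : Finset (Site 2))
          (nAt 0 (Finset.mem_singleton_self 0) 0 * nAt 0 (Finset.mem_singleton_self 0) 1)).re) :
    dWaveSourceEnergyDensityTT' s U μ h ≤ min (R₁ + A * (U - U₁)) (R₂ - B * (U₂ - U)) - μ * n :=
  dWaveSourceEnergyDensityTT'_le_of_energyDensityTT'_le s (hU₁.trans h₁) μ h hn0 hn2
    (energyDensityTT'_U_interval_le_min_tangents_of_doccWords 1 s hU₁ h₁ h₂ hn0 hn2 hR₁ hR₂ hA hB)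

/-- **Sourced `U`-interval cap, kinematic canonical edition**: `E(s,U,μ,h) ≤ min(R₁ + (n/2)(U − U₁), R₂) − μn` on
`[U₁,U₂]`. [cite: Ruelle1969, §3.4] -/
theorem dWaveSourceEnergyDensityTT'_U_interval_le_of_canonical_caps_kinematic (s : ℝ) {U₁ U₂ U : ℝ}
    (hU₁ : 0 ≤ U₁) (h₁ : U₁ ≤ U) (h₂ : U ≤ U₂) {n : ℝ} (hn0 : 0 ≤ n) (hn2 : n < 2) (μ h : ℝ) {R₁ R₂ : ℝ}
    (hR₁ : energyDensityTT' 1 s U₁ n ≤ R₁) (hR₂ : energyDensityTT' 1 s U₂ n ≤ R₂) :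
    dWaveSourceEnergyDensityTT' s U μ h ≤ min (R₁ + n / 2 * (U - U₁)) R₂ - μ * n :=
  dWaveSourceEnergyDensityTT'_le_of_energyDensityTT'_le s (hU₁.trans h₁) μ h hn0 hn2
    (energyDensityTT'_U_interval_le_min_kinematic 1 s hU₁ h₁ h₂ hn0 hn2 hR₁ hR₂)

end CapsCanonical

/-! ### §4 Order-parameter ceilings on a whole `U`-interval -/

section Bulge

/-- **The numerator's BULGE** (algebra): on `[U₁,U₂]` the two-anchor numerator
`min(hi₁ + A(U − U₁), hi₂ − B(U₂ − U)) − chord(lo₁,lo₂;U)` is at most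
`max g₁ g₂ + (U₂ − U₁)·α⁺β⁺/(α⁺ + β⁺)` with `gᵢ = hiᵢ − loᵢ`, `α = A − σ`, `β = σ − B`,
`σ = (lo₂ − lo₁)/(U₂ − U₁)` (the fast cell's `le_max_add_bulge_of_le_two_affine`: each tangent minus the chord is
affine, `g₁ + α(U − U₁)` and `g₂ + β(U₂ − U)`). [cite: Neumaier2004CompleteSearch, §11] -/
theorem min_tangents_sub_chord_le_bulge {U₁ U₂ U hi₁ hi₂ lo₁ lo₂ A B : ℝ} (hlt : U₁ < U₂) (h₁ : U₁ ≤ U)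
    (h₂ : U ≤ U₂) :
    min (hi₁ + A * (U - U₁)) (hi₂ - B * (U₂ - U)) - (lo₁ + (lo₂ - lo₁) * (U - U₁) / (U₂ - U₁)) ≤
      max (hi₁ - lo₁) (hi₂ - lo₂) +
        (U₂ - U₁) * (max (A - (lo₂ - lo₁) / (U₂ - U₁)) 0 * max ((lo₂ - lo₁) / (U₂ - U₁) - B) 0) /
          (max (A - (lo₂ - lo₁) / (U₂ - U₁)) 0 + max ((lo₂ - lo₁) / (U₂ - U₁) - B) 0) := by
  set σ := (lo₂ - lo₁) / (U₂ - U₁) with hσdef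
  have hd : U₂ - U₁ ≠ 0 := ne_of_gt (sub_pos.2 hlt)
  have hσ : σ * (U₂ - U₁) = lo₂ - lo₁ := div_mul_cancel₀ _ hd
  have hchord : (lo₂ - lo₁) * (U - U₁) / (U₂ - U₁) = σ * (U - U₁) := by
    rw [hσdef]
    ring
  rw [hchord]
  have hm₁ := min_le_left (hi₁ + A * (U - U₁)) (hi₂ - B * (U₂ - U))
  have hm₂ := min_le_right (hi₁ + A * (U - U₁)) (hi₂ - B * (U₂ - U))
  have hN1 : min (hi₁ + A * (U - U₁)) (hi₂ - B * (U₂ - U)) - (lo₁ + σ * (U - U₁)) ≤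
      (hi₁ - lo₁) + (A - σ) * (U - U₁) := by linarith
  have hN2 : min (hi₁ + A * (U - U₁)) (hi₂ - B * (U₂ - U)) - (lo₁ + σ * (U - U₁)) ≤
      (hi₂ - lo₂) + (σ - B) * (U₂ - U) := by
    have e : σ * (U₂ - U) + σ * (U - U₁) = lo₂ - lo₁ := by rw [← hσ]; ring
    linarith
  exact le_max_add_bulge_of_le_two_affine h₁ h₂ hN1 hN2

/-- The bulge is never worse than `(U₂ − U₁)·min(α⁺, β⁺)` (and vanishes when `A ≤ σ` or `σ ≤ B`).
[cite: Neumaier2004CompleteSearch, §11] -/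
theorem min_tangents_sub_chord_le_min_slopes {U₁ U₂ U hi₁ hi₂ lo₁ lo₂ A B : ℝ} (hlt : U₁ < U₂) (h₁ : U₁ ≤ U)
    (h₂ : U ≤ U₂) :
    min (hi₁ + A * (U - U₁)) (hi₂ - B * (U₂ - U)) - (lo₁ + (lo₂ - lo₁) * (U - U₁) / (U₂ - U₁)) ≤
      max (hi₁ - lo₁) (hi₂ - lo₂) +
        (U₂ - U₁) * min (max (A - (lo₂ - lo₁) / (U₂ - U₁)) 0) (max ((lo₂ - lo₁) / (U₂ - U₁) - B) 0) := by
  refine (min_tangents_sub_chord_le_bulge hlt h₁ h₂).trans ?_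
  have := mul_div_add_le_min (sub_nonneg.2 hlt.le) (le_max_right (A - (lo₂ - lo₁) / (U₂ - U₁)) 0)
    (le_max_right ((lo₂ - lo₁) / (U₂ - U₁) - B) 0)
  linarith

end Bulge

section OrderGC

/-- **ORDER CEILING ON A WHOLE `U`-INTERVAL from docc WORDS** (grand-canonical words on the SOURCE-FREE ground
states, `h = 0`): source-free caps `E(s,Uᵢ,μ,0) ≤ hiᵢ`, sourced floors `loᵢ ≤ E(s,Uᵢ,μ,h)` (`h > 0`), a docc ceiling
word `A` on the translation-invariant ground states at `(s,U₁,μ,0)` and a docc floor word `B` at `(s,U₂,μ,0)` give,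
for every `U ∈ [U₁,U₂]`,
`m⋆(s,U,μ) ≤ (min(hi₁ + A(U − U₁), hi₂ − B(U₂ − U)) − (lo₁ + (lo₂ − lo₁)(U − U₁)/(U₂ − U₁)))/(2h)`.
[cite: KomaTasaki1994, §1] -/
theorem dWaveOrderParameterTT'_U_interval_le_of_doccWords {s U₁ U₂ μ h hi₁ hi₂ lo₁ lo₂ A B : ℝ} (hh : 0 < h)
    (hlt : U₁ < U₂) (hhi₁ : dWaveSourceEnergyDensityTT' s U₁ μ 0 ≤ hi₁)
    (hhi₂ : dWaveSourceEnergyDensityTT' s U₂ μ 0 ≤ hi₂) (hlo₁ : lo₁ ≤ dWaveSourceEnergyDensityTT' s U₁ μ h)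
    (hlo₂ : lo₂ ≤ dWaveSourceEnergyDensityTT' s U₂ μ h)
    (hA : ∀ ω : InfVolFermionState 2,
      ω.IsMeanEnergyMinimiser (hubbardTTPrimeSourcedInteraction 1 s U₁ μ dWaveFormFactor 0) 1 →
        ω.meanEnergy (hubbardTTPrimeFermionInteraction 0 0 1) 1 ≤ A)
    (hB : ∀ ω : InfVolFermionState 2,
      ω.IsMeanEnergyMinimiser (hubbardTTPrimeSourcedInteraction 1 s U₂ μ dWaveFormFactor 0) 1 →
        B ≤ ω.meanEnergy (hubbardTTPrimeFermionInteraction 0 0 1) 1)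
    {U : ℝ} (h₁ : U₁ ≤ U) (h₂ : U ≤ U₂) :
    dWaveOrderParameterTT' s U μ ≤
      (min (hi₁ + A * (U - U₁)) (hi₂ - B * (U₂ - U)) - (lo₁ + (lo₂ - lo₁) * (U - U₁) / (U₂ - U₁))) /
        (2 * h) :=
  dWaveOrderParameterTT'_le_of_windows s U μ hh (dWaveSourceEnergyDensityTT'_ge_U_chord hlt h₁ h₂ hlo₁ hlo₂)
    (dWaveSourceEnergyDensityTT'_le_min_tangents_of_doccWords h₁ h₂ hhi₁ hhi₂ hA hB)

/-- **UNIFORM BULGE FORM**: under the same hypotheses, for every `U ∈ [U₁,U₂]`,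
`m⋆(s,U,μ) ≤ (max g₁ g₂ + (U₂ − U₁)·α⁺β⁺/(α⁺ + β⁺))/(2h)`, `gᵢ = hiᵢ − loᵢ`, `α = A − σ`, `β = σ − B`,
`σ = (lo₂ − lo₁)/(U₂ − U₁)` — the excess over the two anchor gaps is governed by the distance of the certified docc
ceiling (left) / floor (right) from the certified secant slope of the sourced floors: second order in the width for
docc windows of second-order width. [cite: KomaTasaki1994, §1] -/
theorem dWaveOrderParameterTT'_U_interval_le_bulge_of_doccWords {s U₁ U₂ μ h hi₁ hi₂ lo₁ lo₂ A B : ℝ} (hh : 0 < h)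
    (hlt : U₁ < U₂) (hhi₁ : dWaveSourceEnergyDensityTT' s U₁ μ 0 ≤ hi₁)
    (hhi₂ : dWaveSourceEnergyDensityTT' s U₂ μ 0 ≤ hi₂) (hlo₁ : lo₁ ≤ dWaveSourceEnergyDensityTT' s U₁ μ h)
    (hlo₂ : lo₂ ≤ dWaveSourceEnergyDensityTT' s U₂ μ h)
    (hA : ∀ ω : InfVolFermionState 2,
      ω.IsMeanEnergyMinimiser (hubbardTTPrimeSourcedInteraction 1 s U₁ μ dWaveFormFactor 0) 1 →
        ω.meanEnergy (hubbardTTPrimeFermionInteraction 0 0 1) 1 ≤ A)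
    (hB : ∀ ω : InfVolFermionState 2,
      ω.IsMeanEnergyMinimiser (hubbardTTPrimeSourcedInteraction 1 s U₂ μ dWaveFormFactor 0) 1 →
        B ≤ ω.meanEnergy (hubbardTTPrimeFermionInteraction 0 0 1) 1)
    {U : ℝ} (h₁ : U₁ ≤ U) (h₂ : U ≤ U₂) :
    dWaveOrderParameterTT' s U μ ≤
      (max (hi₁ - lo₁) (hi₂ - lo₂) +
        (U₂ - U₁) * (max (A - (lo₂ - lo₁) / (U₂ - U₁)) 0 * max ((lo₂ - lo₁) / (U₂ - U₁) - B) 0) /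
          (max (A - (lo₂ - lo₁) / (U₂ - U₁)) 0 + max ((lo₂ - lo₁) / (U₂ - U₁) - B) 0)) / (2 * h) :=
  (dWaveOrderParameterTT'_U_interval_le_of_doccWords hh hlt hhi₁ hhi₂ hlo₁ hlo₂ hA hB h₁ h₂).trans
    (div_le_div_of_nonneg_right (min_tangents_sub_chord_le_bulge hlt h₁ h₂) (by positivity))

/-- **ABSENT(`< m₀`) ON A WHOLE `U`-INTERVAL from docc words**: if
`max g₁ g₂ + (U₂ − U₁)·α⁺β⁺/(α⁺ + β⁺) < 2h·m₀` then `m⋆(s,U,μ) < m₀` for every `U ∈ [U₁,U₂]`.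
[cite: KomaTasaki1994, §1] -/
theorem dWaveOrderParameterTT'_lt_on_U_interval_of_doccWords {s U₁ U₂ μ h hi₁ hi₂ lo₁ lo₂ A B m₀ : ℝ}
    (hh : 0 < h) (hlt : U₁ < U₂) (hhi₁ : dWaveSourceEnergyDensityTT' s U₁ μ 0 ≤ hi₁)
    (hhi₂ : dWaveSourceEnergyDensityTT' s U₂ μ 0 ≤ hi₂) (hlo₁ : lo₁ ≤ dWaveSourceEnergyDensityTT' s U₁ μ h)
    (hlo₂ : lo₂ ≤ dWaveSourceEnergyDensityTT' s U₂ μ h)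
    (hA : ∀ ω : InfVolFermionState 2,
      ω.IsMeanEnergyMinimiser (hubbardTTPrimeSourcedInteraction 1 s U₁ μ dWaveFormFactor 0) 1 →
        ω.meanEnergy (hubbardTTPrimeFermionInteraction 0 0 1) 1 ≤ A)
    (hB : ∀ ω : InfVolFermionState 2,
      ω.IsMeanEnergyMinimiser (hubbardTTPrimeSourcedInteraction 1 s U₂ μ dWaveFormFactor 0) 1 →
        B ≤ ω.meanEnergy (hubbardTTPrimeFermionInteraction 0 0 1) 1)
    (habs : max (hi₁ - lo₁) (hi₂ - lo₂) +
        (U₂ - U₁) * (max (A - (lo₂ - lo₁) / (U₂ - U₁)) 0 * max ((lo₂ - lo₁) / (U₂ - U₁) - B) 0) /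
          (max (A - (lo₂ - lo₁) / (U₂ - U₁)) 0 + max ((lo₂ - lo₁) / (U₂ - U₁) - B) 0) < 2 * h * m₀)
    {U : ℝ} (h₁ : U₁ ≤ U) (h₂ : U ≤ U₂) : dWaveOrderParameterTT' s U μ < m₀ := by
  refine (dWaveOrderParameterTT'_U_interval_le_bulge_of_doccWords hh hlt hhi₁ hhi₂ hlo₁ hlo₂ hA hB h₁ h₂).trans_lt ?_
  rw [div_lt_iff₀ (by positivity)]
  linarith

/-- **ONE ANCHOR, RIGHT HALF-RAY, docc ceiling word**: `E(s,U₀,μ,0) ≤ hi₀`, `lo₀ ≤ E(s,U₀,μ,h)` (`h > 0`) and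
«every translation-invariant source-free ground state at `(s,U₀,μ)` has `D ≤ A`» give, for every `U ≥ U₀`,
`m⋆(s,U,μ) ≤ (hi₀ − lo₀ + (U − U₀)·A)/(2h)` — slope `A` instead of the `1` of
`dWaveOrderParameterTT'_le_of_windows_U_box` (the sourced floor moves to larger `U` for free). [cite: KomaTasaki1994, §1] -/
theorem dWaveOrderParameterTT'_le_right_of_windows_of_doccWord {s U₀ μ h hi₀ lo₀ A : ℝ} (hh : 0 < h)
    (hhi : dWaveSourceEnergyDensityTT' s U₀ μ 0 ≤ hi₀) (hlo : lo₀ ≤ dWaveSourceEnergyDensityTT' s U₀ μ h)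
    (hA : ∀ ω : InfVolFermionState 2,
      ω.IsMeanEnergyMinimiser (hubbardTTPrimeSourcedInteraction 1 s U₀ μ dWaveFormFactor 0) 1 →
        ω.meanEnergy (hubbardTTPrimeFermionInteraction 0 0 1) 1 ≤ A)
    {U : ℝ} (hU : U₀ ≤ U) : dWaveOrderParameterTT' s U μ ≤ (hi₀ - lo₀ + (U - U₀) * A) / (2 * h) := by
  have key := dWaveOrderParameterTT'_le_of_windows s U μ hh
    (dWaveSourceEnergyDensityTT'_ge_of_ge_at_smaller_U s μ h hU hlo)
    (dWaveSourceEnergyDensityTT'_le_anchorCap_add_mul_of_doccWord hhi hA hU)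
  have e : hi₀ + (U - U₀) * A - lo₀ = hi₀ - lo₀ + (U - U₀) * A := by ring
  rwa [e] at key

end OrderGC

section OrderCanonical

/-- **ORDER CEILING ON A WHOLE `U`-INTERVAL, CANONICAL docc-word edition** (the certificate format of record):
canonical caps `e(1,s,Uᵢ,n) ≤ Rᵢ` (`0 ≤ U₁ < U₂`, `0 ≤ n < 2`), a docc CEILING word `A` on the torus-limit ground
states at `U₁`, a docc FLOOR word `B` at `U₂`, and sourced floors `loᵢ ≤ E(s,Uᵢ,μ,h)` (`h > 0`) give, for every
`U ∈ [U₁,U₂]`, `m⋆(s,U,μ) ≤ (min(R₁ + A(U − U₁), R₂ − B(U₂ − U)) − μn − chord(lo₁,lo₂;U))/(2h)`.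
[cite: KomaTasaki1994, §1] -/
theorem dWaveOrderParameterTT'_U_interval_le_of_canonical_doccWords (s : ℝ) {U₁ U₂ : ℝ} (hU₁ : 0 ≤ U₁)
    (hlt : U₁ < U₂) {n : ℝ} (hn0 : 0 ≤ n) (hn2 : n < 2) {μ h : ℝ} (hh : 0 < h) {R₁ R₂ A B lo₁ lo₂ : ℝ}
    (hR₁ : energyDensityTT' 1 s U₁ n ≤ R₁) (hR₂ : energyDensityTT' 1 s U₂ n ≤ R₂)
    (hA : ∀ (ω : InfVolFermionState 2) (Ls : ℕ → ℕ) (ψ : ∀ L, Fock (Orb (FermionTorus 2 L))),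
      Tendsto Ls atTop atTop →
      (∀ j, IsGroundStateInSector (hubbardTorusTT' (Ls j) 1 s U₁) (rectN n (Ls j)) 0 (ψ (Ls j))) →
      (∀ j, star (ψ (Ls j)) ⬝ᵥ ψ (Ls j) = 1) → ω.IsTorusLimitOf ψ Ls →
      (ω.expect ({0} : Finset (Site 2))
          (nAt 0 (Finset.mem_singleton_self 0) 0 * nAt 0 (Finset.mem_singleton_self 0) 1)).re ≤ A)
    (hB : ∀ (ω : InfVolFermionState 2) (Ls : ℕ → ℕ) (ψ : ∀ L, Fock (Orb (FermionTorus 2 L))),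
      Tendsto Ls atTop atTop →
      (∀ j, IsGroundStateInSector (hubbardTorusTT' (Ls j) 1 s U₂) (rectN n (Ls j)) 0 (ψ (Ls j))) →
      (∀ j, star (ψ (Ls j)) ⬝ᵥ ψ (Ls j) = 1) → ω.IsTorusLimitOf ψ Ls →
      B ≤ (ω.expect ({0} : Finset (Site 2))
          (nAt 0 (Finset.mem_singleton_self 0) 0 * nAt 0 (Finset.mem_singleton_self 0) 1)).re)
    (hlo₁ : lo₁ ≤ dWaveSourceEnergyDensityTT' s U₁ μ h) (hlo₂ : lo₂ ≤ dWaveSourceEnergyDensityTT' s U₂ μ h)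
    {U : ℝ} (h₁ : U₁ ≤ U) (h₂ : U ≤ U₂) :
    dWaveOrderParameterTT' s U μ ≤
      (min (R₁ + A * (U - U₁)) (R₂ - B * (U₂ - U)) - μ * n -
        (lo₁ + (lo₂ - lo₁) * (U - U₁) / (U₂ - U₁))) / (2 * h) :=
  dWaveOrderParameterTT'_le_of_windows s U μ hh (dWaveSourceEnergyDensityTT'_ge_U_chord hlt h₁ h₂ hlo₁ hlo₂)
    (dWaveSourceEnergyDensityTT'_U_interval_le_of_canonical_doccWords s hU₁ h₁ h₂ hn0 hn2 μ 0 hR₁ hR₂ hA hB)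

/-- **CANONICAL BULGE FORM**: with the gaps `gᵢ = Rᵢ − μn − loᵢ`, for every `U ∈ [U₁,U₂]`,
`m⋆(s,U,μ) ≤ (max g₁ g₂ + (U₂ − U₁)·α⁺β⁺/(α⁺ + β⁺))/(2h)`, `α = A − σ`, `β = σ − B`, `σ = (lo₂ − lo₁)/(U₂ − U₁)`.
[cite: KomaTasaki1994, §1] -/
theorem dWaveOrderParameterTT'_U_interval_le_bulge_of_canonical_doccWords (s : ℝ) {U₁ U₂ : ℝ} (hU₁ : 0 ≤ U₁)
    (hlt : U₁ < U₂) {n : ℝ} (hn0 : 0 ≤ n) (hn2 : n < 2) {μ h : ℝ} (hh : 0 < h) {R₁ R₂ A B lo₁ lo₂ : ℝ}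
    (hR₁ : energyDensityTT' 1 s U₁ n ≤ R₁) (hR₂ : energyDensityTT' 1 s U₂ n ≤ R₂)
    (hA : ∀ (ω : InfVolFermionState 2) (Ls : ℕ → ℕ) (ψ : ∀ L, Fock (Orb (FermionTorus 2 L))),
      Tendsto Ls atTop atTop →
      (∀ j, IsGroundStateInSector (hubbardTorusTT' (Ls j) 1 s U₁) (rectN n (Ls j)) 0 (ψ (Ls j))) →
      (∀ j, star (ψ (Ls j)) ⬝ᵥ ψ (Ls j) = 1) → ω.IsTorusLimitOf ψ Ls →
      (ω.expect ({0} : Finset (Site 2))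
          (nAt 0 (Finset.mem_singleton_self 0) 0 * nAt 0 (Finset.mem_singleton_self 0) 1)).re ≤ A)
    (hB : ∀ (ω : InfVolFermionState 2) (Ls : ℕ → ℕ) (ψ : ∀ L, Fock (Orb (FermionTorus 2 L))),
      Tendsto Ls atTop atTop →
      (∀ j, IsGroundStateInSector (hubbardTorusTT' (Ls j) 1 s U₂) (rectN n (Ls j)) 0 (ψ (Ls j))) →
      (∀ j, star (ψ (Ls j)) ⬝ᵥ ψ (Ls j) = 1) → ω.IsTorusLimitOf ψ Ls →
      B ≤ (ω.expect ({0} : Finset (Site 2))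
          (nAt 0 (Finset.mem_singleton_self 0) 0 * nAt 0 (Finset.mem_singleton_self 0) 1)).re)
    (hlo₁ : lo₁ ≤ dWaveSourceEnergyDensityTT' s U₁ μ h) (hlo₂ : lo₂ ≤ dWaveSourceEnergyDensityTT' s U₂ μ h)
    {U : ℝ} (h₁ : U₁ ≤ U) (h₂ : U ≤ U₂) :
    dWaveOrderParameterTT' s U μ ≤
      (max (R₁ - μ * n - lo₁) (R₂ - μ * n - lo₂) +
        (U₂ - U₁) * (max (A - (lo₂ - lo₁) / (U₂ - U₁)) 0 * max ((lo₂ - lo₁) / (U₂ - U₁) - B) 0) /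
          (max (A - (lo₂ - lo₁) / (U₂ - U₁)) 0 + max ((lo₂ - lo₁) / (U₂ - U₁) - B) 0)) / (2 * h) := by
  refine (dWaveOrderParameterTT'_U_interval_le_of_canonical_doccWords s hU₁ hlt hn0 hn2 hh hR₁ hR₂ hA hB hlo₁
    hlo₂ h₁ h₂).trans (div_le_div_of_nonneg_right ?_ (by positivity))
  have hb := min_tangents_sub_chord_le_bulge (hi₁ := R₁ - μ * n) (hi₂ := R₂ - μ * n) (lo₁ := lo₁) (lo₂ := lo₂)
    (A := A) (B := B) hlt h₁ h₂
  have e : min (R₁ + A * (U - U₁)) (R₂ - B * (U₂ - U)) - μ * n =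
      min (R₁ - μ * n + A * (U - U₁)) (R₂ - μ * n - B * (U₂ - U)) := by
    rw [← min_sub_sub_right]
    congr 1 <;> ring
  rw [e]
  exact hb

/-- **ABSENT(`< m₀`) ON A WHOLE `U`-INTERVAL, canonical edition**: if
`max g₁ g₂ + (U₂ − U₁)·α⁺β⁺/(α⁺ + β⁺) < 2h·m₀` (`gᵢ = Rᵢ − μn − loᵢ`) then `m⋆(s,U,μ) < m₀` on `[U₁,U₂]`.
[cite: KomaTasaki1994, §1] -/
theorem dWaveOrderParameterTT'_lt_on_U_interval_of_canonical_doccWords (s : ℝ) {U₁ U₂ : ℝ} (hU₁ : 0 ≤ U₁)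
    (hlt : U₁ < U₂) {n : ℝ} (hn0 : 0 ≤ n) (hn2 : n < 2) {μ h : ℝ} (hh : 0 < h) {R₁ R₂ A B lo₁ lo₂ m₀ : ℝ}
    (hR₁ : energyDensityTT' 1 s U₁ n ≤ R₁) (hR₂ : energyDensityTT' 1 s U₂ n ≤ R₂)
    (hA : ∀ (ω : InfVolFermionState 2) (Ls : ℕ → ℕ) (ψ : ∀ L, Fock (Orb (FermionTorus 2 L))),
      Tendsto Ls atTop atTop →
      (∀ j, IsGroundStateInSector (hubbardTorusTT' (Ls j) 1 s U₁) (rectN n (Ls j)) 0 (ψ (Ls j))) →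
      (∀ j, star (ψ (Ls j)) ⬝ᵥ ψ (Ls j) = 1) → ω.IsTorusLimitOf ψ Ls →
      (ω.expect ({0} : Finset (Site 2))
          (nAt 0 (Finset.mem_singleton_self 0) 0 * nAt 0 (Finset.mem_singleton_self 0) 1)).re ≤ A)
    (hB : ∀ (ω : InfVolFermionState 2) (Ls : ℕ → ℕ) (ψ : ∀ L, Fock (Orb (FermionTorus 2 L))),
      Tendsto Ls atTop atTop →
      (∀ j, IsGroundStateInSector (hubbardTorusTT' (Ls j) 1 s U₂) (rectN n (Ls j)) 0 (ψ (Ls j))) →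
      (∀ j, star (ψ (Ls j)) ⬝ᵥ ψ (Ls j) = 1) → ω.IsTorusLimitOf ψ Ls →
      B ≤ (ω.expect ({0} : Finset (Site 2))
          (nAt 0 (Finset.mem_singleton_self 0) 0 * nAt 0 (Finset.mem_singleton_self 0) 1)).re)
    (hlo₁ : lo₁ ≤ dWaveSourceEnergyDensityTT' s U₁ μ h) (hlo₂ : lo₂ ≤ dWaveSourceEnergyDensityTT' s U₂ μ h)
    (habs : max (R₁ - μ * n - lo₁) (R₂ - μ * n - lo₂) +
        (U₂ - U₁) * (max (A - (lo₂ - lo₁) / (U₂ - U₁)) 0 * max ((lo₂ - lo₁) / (U₂ - U₁) - B) 0) /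
          (max (A - (lo₂ - lo₁) / (U₂ - U₁)) 0 + max ((lo₂ - lo₁) / (U₂ - U₁) - B) 0) < 2 * h * m₀)
    {U : ℝ} (h₁ : U₁ ≤ U) (h₂ : U ≤ U₂) : dWaveOrderParameterTT' s U μ < m₀ := by
  refine (dWaveOrderParameterTT'_U_interval_le_bulge_of_canonical_doccWords s hU₁ hlt hn0 hn2 hh hR₁ hR₂ hA hB
    hlo₁ hlo₂ h₁ h₂).trans_lt ?_
  rw [div_lt_iff₀ (by positivity)]
  linarith

/-- **KINEMATIC canonical edition** (no docc word; `A = n/2`, `B = 0`): for every `U ∈ [U₁,U₂]`,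
`m⋆(s,U,μ) ≤ (min(R₁ + (n/2)(U − U₁), R₂) − μn − chord(lo₁,lo₂;U))/(2h)` — already below the monotone cell rule
`(R₂ − μn − min lo₁ lo₂)/(2h)` of `dWaveOrderParameterTT'_box₃_le_of_canonical_intervalCap`. [cite: KomaTasaki1994, §1] -/
theorem dWaveOrderParameterTT'_U_interval_le_of_canonical_caps_kinematic (s : ℝ) {U₁ U₂ : ℝ} (hU₁ : 0 ≤ U₁)
    (hlt : U₁ < U₂) {n : ℝ} (hn0 : 0 ≤ n) (hn2 : n < 2) {μ h : ℝ} (hh : 0 < h) {R₁ R₂ lo₁ lo₂ : ℝ}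
    (hR₁ : energyDensityTT' 1 s U₁ n ≤ R₁) (hR₂ : energyDensityTT' 1 s U₂ n ≤ R₂)
    (hlo₁ : lo₁ ≤ dWaveSourceEnergyDensityTT' s U₁ μ h) (hlo₂ : lo₂ ≤ dWaveSourceEnergyDensityTT' s U₂ μ h)
    {U : ℝ} (h₁ : U₁ ≤ U) (h₂ : U ≤ U₂) :
    dWaveOrderParameterTT' s U μ ≤
      (min (R₁ + n / 2 * (U - U₁)) R₂ - μ * n - (lo₁ + (lo₂ - lo₁) * (U - U₁) / (U₂ - U₁))) / (2 * h) :=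
  dWaveOrderParameterTT'_le_of_windows s U μ hh (dWaveSourceEnergyDensityTT'_ge_U_chord hlt h₁ h₂ hlo₁ hlo₂)
    (dWaveSourceEnergyDensityTT'_U_interval_le_of_canonical_caps_kinematic s hU₁ h₁ h₂ hn0 hn2 μ 0 hR₁ hR₂)

/-- **ONE ANCHOR, RIGHT HALF-RAY, canonical docc ceiling word**: `e(1,s,U₀,n) ≤ R` (`U₀ ≥ 0`, `0 ≤ n < 2`), a docc
ceiling word `A` on the torus-limit ground states at `U₀` and a sourced floor `lo₀ ≤ E(s,U₀,μ,h)` (`h > 0`) give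
`m⋆(s,U,μ) ≤ (R − μn − lo₀ + (U − U₀)·A)/(2h)` for every `U ≥ U₀`. [cite: KomaTasaki1994, §1] -/
theorem dWaveOrderParameterTT'_le_right_of_canonicalCap_of_doccWord (s : ℝ) {U₀ : ℝ} (hU₀ : 0 ≤ U₀) {n : ℝ}
    (hn0 : 0 ≤ n) (hn2 : n < 2) {μ h : ℝ} (hh : 0 < h) {R A lo₀ : ℝ} (hR : energyDensityTT' 1 s U₀ n ≤ R)
    (hA : ∀ (ω : InfVolFermionState 2) (Ls : ℕ → ℕ) (ψ : ∀ L, Fock (Orb (FermionTorus 2 L))),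
      Tendsto Ls atTop atTop →
      (∀ j, IsGroundStateInSector (hubbardTorusTT' (Ls j) 1 s U₀) (rectN n (Ls j)) 0 (ψ (Ls j))) →
      (∀ j, star (ψ (Ls j)) ⬝ᵥ ψ (Ls j) = 1) → ω.IsTorusLimitOf ψ Ls →
      (ω.expect ({0} : Finset (Site 2))
          (nAt 0 (Finset.mem_singleton_self 0) 0 * nAt 0 (Finset.mem_singleton_self 0) 1)).re ≤ A)
    (hlo : lo₀ ≤ dWaveSourceEnergyDensityTT' s U₀ μ h) {U : ℝ} (hU : U₀ ≤ U) :
    dWaveOrderParameterTT' s U μ ≤ (R - μ * n - lo₀ + (U - U₀) * A) / (2 * h) := by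
  have hcap := dWaveSourceEnergyDensityTT'_le_of_energyDensityTT'_le s (hU₀.trans hU) μ 0 hn0 hn2
    (energyDensityTT'_le_cap_add_mul_of_forall_isTorusLimitOf_docc_le 1 s hU₀ hn0 hn2 hR hA hU)
  have key := dWaveOrderParameterTT'_le_of_windows s U μ hh
    (dWaveSourceEnergyDensityTT'_ge_of_ge_at_smaller_U s μ h hU hlo) hcap
  have e : R + (U - U₀) * A - μ * n - lo₀ = R - μ * n - lo₀ + (U - U₀) * A := by ring
  rwa [e] at key

end OrderCanonical

/-! ### §5 `[U₁,U₂] × [μ₁,μ₂]` cells (caps read at `μ₁`, floors at `μ₂`) -/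

section Cells

/-- **ORDER CEILING ON A `U × μ` CELL, canonical docc-word edition**: canonical caps `Rᵢ` and docc words `A`
(ceiling at `U₁`) / `B` (floor at `U₂`) as in §4, sourced floors `loᵢ ≤ E(s,Uᵢ,μ₂,h)` at the UPPER chemical potential
`μ₂` (`h > 0`): for every `(U, μ) ∈ [U₁,U₂] × [μ₁,μ₂]`,
`m⋆(s,U,μ) ≤ (min(R₁ + A(U − U₁), R₂ − B(U₂ − U)) − μ₁n − chord(lo₁,lo₂;U))/(2h)` (`E` is non-increasing in `μ`;
the Legendre cap carries `−μn ≤ −μ₁n`). [cite: KomaTasaki1994, §1] -/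
theorem dWaveOrderParameterTT'_U_mu_cell_le_of_canonical_doccWords (s : ℝ) {U₁ U₂ : ℝ} (hU₁ : 0 ≤ U₁)
    (hlt : U₁ < U₂) {n : ℝ} (hn0 : 0 ≤ n) (hn2 : n < 2) {μ₁ μ₂ h : ℝ} (hh : 0 < h) {R₁ R₂ A B lo₁ lo₂ : ℝ}
    (hR₁ : energyDensityTT' 1 s U₁ n ≤ R₁) (hR₂ : energyDensityTT' 1 s U₂ n ≤ R₂)
    (hA : ∀ (ω : InfVolFermionState 2) (Ls : ℕ → ℕ) (ψ : ∀ L, Fock (Orb (FermionTorus 2 L))),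
      Tendsto Ls atTop atTop →
      (∀ j, IsGroundStateInSector (hubbardTorusTT' (Ls j) 1 s U₁) (rectN n (Ls j)) 0 (ψ (Ls j))) →
      (∀ j, star (ψ (Ls j)) ⬝ᵥ ψ (Ls j) = 1) → ω.IsTorusLimitOf ψ Ls →
      (ω.expect ({0} : Finset (Site 2))
          (nAt 0 (Finset.mem_singleton_self 0) 0 * nAt 0 (Finset.mem_singleton_self 0) 1)).re ≤ A)
    (hB : ∀ (ω : InfVolFermionState 2) (Ls : ℕ → ℕ) (ψ : ∀ L, Fock (Orb (FermionTorus 2 L))),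
      Tendsto Ls atTop atTop →
      (∀ j, IsGroundStateInSector (hubbardTorusTT' (Ls j) 1 s U₂) (rectN n (Ls j)) 0 (ψ (Ls j))) →
      (∀ j, star (ψ (Ls j)) ⬝ᵥ ψ (Ls j) = 1) → ω.IsTorusLimitOf ψ Ls →
      B ≤ (ω.expect ({0} : Finset (Site 2))
          (nAt 0 (Finset.mem_singleton_self 0) 0 * nAt 0 (Finset.mem_singleton_self 0) 1)).re)
    (hlo₁ : lo₁ ≤ dWaveSourceEnergyDensityTT' s U₁ μ₂ h) (hlo₂ : lo₂ ≤ dWaveSourceEnergyDensityTT' s U₂ μ₂ h)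
    {U μ : ℝ} (h₁ : U₁ ≤ U) (h₂ : U ≤ U₂) (hμ₁ : μ₁ ≤ μ) (hμ₂ : μ ≤ μ₂) :
    dWaveOrderParameterTT' s U μ ≤
      (min (R₁ + A * (U - U₁)) (R₂ - B * (U₂ - U)) - μ₁ * n -
        (lo₁ + (lo₂ - lo₁) * (U - U₁) / (U₂ - U₁))) / (2 * h) :=
  dWaveOrderParameterTT'_le_of_windows s U μ hh
    ((dWaveSourceEnergyDensityTT'_ge_U_chord hlt h₁ h₂ hlo₁ hlo₂).trans
      (dWaveSourceEnergyDensityTT'_antitone_mu s U h hμ₂))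
    ((dWaveSourceEnergyDensityTT'_antitone_mu s U 0 hμ₁).trans
      (dWaveSourceEnergyDensityTT'_U_interval_le_of_canonical_doccWords s hU₁ h₁ h₂ hn0 hn2 μ₁ 0 hR₁ hR₂ hA hB))

/-- **ABSENT(`< m₀`) ON A WHOLE `U × μ` CELL, canonical docc-word edition**: if
`max g₁ g₂ + (U₂ − U₁)·α⁺β⁺/(α⁺ + β⁺) < 2h·m₀` with `gᵢ = Rᵢ − μ₁n − loᵢ` (floors `loᵢ` certified at `μ₂`), then
`m⋆(s,U,μ) < m₀` on `[U₁,U₂] × [μ₁,μ₂]`. [cite: KomaTasaki1994, §1] -/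
theorem dWaveOrderParameterTT'_lt_on_U_mu_cell_of_canonical_doccWords (s : ℝ) {U₁ U₂ : ℝ} (hU₁ : 0 ≤ U₁)
    (hlt : U₁ < U₂) {n : ℝ} (hn0 : 0 ≤ n) (hn2 : n < 2) {μ₁ μ₂ h : ℝ} (hh : 0 < h) {R₁ R₂ A B lo₁ lo₂ m₀ : ℝ}
    (hR₁ : energyDensityTT' 1 s U₁ n ≤ R₁) (hR₂ : energyDensityTT' 1 s U₂ n ≤ R₂)
    (hA : ∀ (ω : InfVolFermionState 2) (Ls : ℕ → ℕ) (ψ : ∀ L, Fock (Orb (FermionTorus 2 L))),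
      Tendsto Ls atTop atTop →
      (∀ j, IsGroundStateInSector (hubbardTorusTT' (Ls j) 1 s U₁) (rectN n (Ls j)) 0 (ψ (Ls j))) →
      (∀ j, star (ψ (Ls j)) ⬝ᵥ ψ (Ls j) = 1) → ω.IsTorusLimitOf ψ Ls →
      (ω.expect ({0} : Finset (Site 2))
          (nAt 0 (Finset.mem_singleton_self 0) 0 * nAt 0 (Finset.mem_singleton_self 0) 1)).re ≤ A)
    (hB : ∀ (ω : InfVolFermionState 2) (Ls : ℕ → ℕ) (ψ : ∀ L, Fock (Orb (FermionTorus 2 L))),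
      Tendsto Ls atTop atTop →
      (∀ j, IsGroundStateInSector (hubbardTorusTT' (Ls j) 1 s U₂) (rectN n (Ls j)) 0 (ψ (Ls j))) →
      (∀ j, star (ψ (Ls j)) ⬝ᵥ ψ (Ls j) = 1) → ω.IsTorusLimitOf ψ Ls →
      B ≤ (ω.expect ({0} : Finset (Site 2))
          (nAt 0 (Finset.mem_singleton_self 0) 0 * nAt 0 (Finset.mem_singleton_self 0) 1)).re)
    (hlo₁ : lo₁ ≤ dWaveSourceEnergyDensityTT' s U₁ μ₂ h) (hlo₂ : lo₂ ≤ dWaveSourceEnergyDensityTT' s U₂ μ₂ h)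
    (habs : max (R₁ - μ₁ * n - lo₁) (R₂ - μ₁ * n - lo₂) +
        (U₂ - U₁) * (max (A - (lo₂ - lo₁) / (U₂ - U₁)) 0 * max ((lo₂ - lo₁) / (U₂ - U₁) - B) 0) /
          (max (A - (lo₂ - lo₁) / (U₂ - U₁)) 0 + max ((lo₂ - lo₁) / (U₂ - U₁) - B) 0) < 2 * h * m₀)
    {U μ : ℝ} (h₁ : U₁ ≤ U) (h₂ : U ≤ U₂) (hμ₁ : μ₁ ≤ μ) (hμ₂ : μ ≤ μ₂) :
    dWaveOrderParameterTT' s U μ < m₀ := by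
  have key := dWaveOrderParameterTT'_U_mu_cell_le_of_canonical_doccWords s hU₁ hlt hn0 hn2 hh hR₁ hR₂ hA hB hlo₁
    hlo₂ h₁ h₂ hμ₁ hμ₂
  have hb := min_tangents_sub_chord_le_bulge (hi₁ := R₁ - μ₁ * n) (hi₂ := R₂ - μ₁ * n) (lo₁ := lo₁) (lo₂ := lo₂)
    (A := A) (B := B) hlt h₁ h₂
  have e : min (R₁ + A * (U - U₁)) (R₂ - B * (U₂ - U)) - μ₁ * n =
      min (R₁ - μ₁ * n + A * (U - U₁)) (R₂ - μ₁ * n - B * (U₂ - U)) := by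
    rw [← min_sub_sub_right]
    congr 1 <;> ring
  rw [e] at key
  refine (key.trans (div_le_div_of_nonneg_right hb (by positivity))).trans_lt ?_
  rw [div_lt_iff₀ (by positivity)]
  linarith

/-- **ORDER CEILING ON A `U × μ` CELL, grand-canonical docc-word edition**: source-free caps `hiᵢ` and docc words at
`(s,Uᵢ,μ₁,0)`, sourced floors `loᵢ` at `(s,Uᵢ,μ₂,h)`: the §4 bound holds on `[U₁,U₂] × [μ₁,μ₂]`.
[cite: KomaTasaki1994, §1] -/
theorem dWaveOrderParameterTT'_U_mu_cell_le_of_doccWords {s U₁ U₂ μ₁ μ₂ h hi₁ hi₂ lo₁ lo₂ A B : ℝ} (hh : 0 < h)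
    (hlt : U₁ < U₂) (hhi₁ : dWaveSourceEnergyDensityTT' s U₁ μ₁ 0 ≤ hi₁)
    (hhi₂ : dWaveSourceEnergyDensityTT' s U₂ μ₁ 0 ≤ hi₂) (hlo₁ : lo₁ ≤ dWaveSourceEnergyDensityTT' s U₁ μ₂ h)
    (hlo₂ : lo₂ ≤ dWaveSourceEnergyDensityTT' s U₂ μ₂ h)
    (hA : ∀ ω : InfVolFermionState 2,
      ω.IsMeanEnergyMinimiser (hubbardTTPrimeSourcedInteraction 1 s U₁ μ₁ dWaveFormFactor 0) 1 →
        ω.meanEnergy (hubbardTTPrimeFermionInteraction 0 0 1) 1 ≤ A)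
    (hB : ∀ ω : InfVolFermionState 2,
      ω.IsMeanEnergyMinimiser (hubbardTTPrimeSourcedInteraction 1 s U₂ μ₁ dWaveFormFactor 0) 1 →
        B ≤ ω.meanEnergy (hubbardTTPrimeFermionInteraction 0 0 1) 1)
    {U μ : ℝ} (h₁ : U₁ ≤ U) (h₂ : U ≤ U₂) (hμ₁ : μ₁ ≤ μ) (hμ₂ : μ ≤ μ₂) :
    dWaveOrderParameterTT' s U μ ≤
      (min (hi₁ + A * (U - U₁)) (hi₂ - B * (U₂ - U)) - (lo₁ + (lo₂ - lo₁) * (U - U₁) / (U₂ - U₁))) /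
        (2 * h) :=
  dWaveOrderParameterTT'_le_of_windows s U μ hh
    ((dWaveSourceEnergyDensityTT'_ge_U_chord hlt h₁ h₂ hlo₁ hlo₂).trans
      (dWaveSourceEnergyDensityTT'_antitone_mu s U h hμ₂))
    ((dWaveSourceEnergyDensityTT'_antitone_mu s U 0 hμ₁).trans
      (dWaveSourceEnergyDensityTT'_le_min_tangents_of_doccWords h₁ h₂ hhi₁ hhi₂ hA hB))

end Cells

/-! ### §6 The near-minimiser pair-amplitude currency of the downfold seam (object M, `t''` on) -/

section PairAmplitude

/-- **PAIR-AMPLITUDE CEILING ON A `U`-INTERVAL from docc words** (grand-canonical edition; the `U`-cell twin of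
`meanEnergy_pairSource_le_of_windows_tpp`): with the §4 data at the column `(s, ·, μ)` — source-free caps `hiᵢ`,
sourced floors `loᵢ` (`h > 0`), docc words `A` at `U₁` / `B` at `U₂` on the source-free translation-invariant ground
states — every translation-invariant `ε`-near-minimiser `σ` of source-free object M `(1, s, t'', U, μ)` with
`U ∈ [U₁,U₂]` has `e_P(σ) ≤ (min(hi₁ + A(U − U₁), hi₂ − B(U₂ − U)) − chord(lo₁,lo₂;U) + (32/π²)|t''| + ε)/h`.
[cite: KomaTasaki1994, §1] -/
theorem meanEnergy_pairSource_le_of_U_interval_doccWords_tpp {s U₁ U₂ μ h hi₁ hi₂ lo₁ lo₂ A B : ℝ}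
    (hh : 0 < h) (hlt : U₁ < U₂) (hhi₁ : dWaveSourceEnergyDensityTT' s U₁ μ 0 ≤ hi₁)
    (hhi₂ : dWaveSourceEnergyDensityTT' s U₂ μ 0 ≤ hi₂) (hlo₁ : lo₁ ≤ dWaveSourceEnergyDensityTT' s U₁ μ h)
    (hlo₂ : lo₂ ≤ dWaveSourceEnergyDensityTT' s U₂ μ h)
    (hA : ∀ ω : InfVolFermionState 2,
      ω.IsMeanEnergyMinimiser (hubbardTTPrimeSourcedInteraction 1 s U₁ μ dWaveFormFactor 0) 1 →
        ω.meanEnergy (hubbardTTPrimeFermionInteraction 0 0 1) 1 ≤ A)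
    (hB : ∀ ω : InfVolFermionState 2,
      ω.IsMeanEnergyMinimiser (hubbardTTPrimeSourcedInteraction 1 s U₂ μ dWaveFormFactor 0) 1 →
        B ≤ ω.meanEnergy (hubbardTTPrimeFermionInteraction 0 0 1) 1)
    {U : ℝ} (h₁ : U₁ ≤ U) (h₂ : U ≤ U₂) (t'' : ℝ) {ε : ℝ} {σ : InfVolFermionState 2}
    (hσ : σ.IsTranslationInvariant)
    (hε : σ.meanEnergy (hubbardTT'T''SourcedInteraction 1 s t'' U μ dWaveFormFactor 0) 2 ≤
      (hubbardTT'T''SourcedInteraction 1 s t'' U μ dWaveFormFactor 0).tiGroundEnergyDensity 2 + ε) :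
    σ.meanEnergy (pairSourceInteraction dWaveFormFactor) 1 ≤
      (min (hi₁ + A * (U - U₁)) (hi₂ - B * (U₂ - U)) - (lo₁ + (lo₂ - lo₁) * (U - U₁) / (U₂ - U₁)) +
        32 / Real.pi ^ 2 * |t''| + ε) / h := by
  have hcap := dWaveSourceEnergyDensityTT'_le_min_tangents_of_doccWords h₁ h₂ hhi₁ hhi₂ hA hB
  have hfl := dWaveSourceEnergyDensityTT'_ge_U_chord hlt h₁ h₂ hlo₁ hlo₂
  refine (meanEnergy_pairSource_le_secant_tpp s U μ t'' hh hσ hε).trans (div_le_div_of_nonneg_right ?_ hh.le)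
  linarith

/-- **THE BOX FORM IN `(t', U, μ ; t'')` WITH A `U`-CELL** (grand-canonical edition; the replacement of
`meanEnergy_pairSource_le_of_windows_couplings4`): the §4 data at the column `(s, [U₁,U₂], μ)` bound the `d`-wave pair
amplitude of every translation-invariant `ε`-near-minimiser of source-free object M at ANY `(t', t'', U, μ')` with
`U ∈ [U₁,U₂]`:
`e_P(σ) ≤ (min(…) − chord(…;U) + (32/π²)|t' − s| + 2|μ' − μ| + (32/π²)|t''| + ε)/h` — the `U`-term of the old box
form (`|U − U₀|·1`) is now the two-anchor bulge, the `t'`-term carries `32/π²` instead of `8`.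
[cite: Israel1979, Thm. I.3.4] -/
theorem meanEnergy_pairSource_le_of_U_interval_doccWords_couplings4 {s U₁ U₂ μ h hi₁ hi₂ lo₁ lo₂ A B : ℝ}
    (hh : 0 < h) (hlt : U₁ < U₂) (hhi₁ : dWaveSourceEnergyDensityTT' s U₁ μ 0 ≤ hi₁)
    (hhi₂ : dWaveSourceEnergyDensityTT' s U₂ μ 0 ≤ hi₂) (hlo₁ : lo₁ ≤ dWaveSourceEnergyDensityTT' s U₁ μ h)
    (hlo₂ : lo₂ ≤ dWaveSourceEnergyDensityTT' s U₂ μ h)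
    (hA : ∀ ω : InfVolFermionState 2,
      ω.IsMeanEnergyMinimiser (hubbardTTPrimeSourcedInteraction 1 s U₁ μ dWaveFormFactor 0) 1 →
        ω.meanEnergy (hubbardTTPrimeFermionInteraction 0 0 1) 1 ≤ A)
    (hB : ∀ ω : InfVolFermionState 2,
      ω.IsMeanEnergyMinimiser (hubbardTTPrimeSourcedInteraction 1 s U₂ μ dWaveFormFactor 0) 1 →
        B ≤ ω.meanEnergy (hubbardTTPrimeFermionInteraction 0 0 1) 1)
    {U : ℝ} (h₁ : U₁ ≤ U) (h₂ : U ≤ U₂) (t' μ' t'' : ℝ) {ε : ℝ} {σ : InfVolFermionState 2}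
    (hσ : σ.IsTranslationInvariant)
    (hε : σ.meanEnergy (hubbardTT'T''SourcedInteraction 1 t' t'' U μ' dWaveFormFactor 0) 2 ≤
      (hubbardTT'T''SourcedInteraction 1 t' t'' U μ' dWaveFormFactor 0).tiGroundEnergyDensity 2 + ε) :
    σ.meanEnergy (pairSourceInteraction dWaveFormFactor) 1 ≤
      (min (hi₁ + A * (U - U₁)) (hi₂ - B * (U₂ - U)) - (lo₁ + (lo₂ - lo₁) * (U - U₁) / (U₂ - U₁)) +
        32 / Real.pi ^ 2 * |t' - s| + 2 * |μ' - μ| + 32 / Real.pi ^ 2 * |t''| + ε) / h := by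
  have hcap := dWaveSourceEnergyDensityTT'_le_min_tangents_of_doccWords h₁ h₂ hhi₁ hhi₂ hA hB
  have hfl := dWaveSourceEnergyDensityTT'_ge_U_chord hlt h₁ h₂ hlo₁ hlo₂
  have htp := secant_dWaveSourceEnergyDensityTT'_sub_tp_le_kinematic U μ' 0 h s t'
  have hmu := secant_dWaveSourceEnergyDensityTT'_sub_mu_le s U 0 h μ μ'
  refine (meanEnergy_pairSource_le_secant_tpp t' U μ' t'' hh hσ hε).trans (div_le_div_of_nonneg_right ?_ hh.le)
  linarith

/-- **PAIR-AMPLITUDE CEILING ON A `U × μ` CELL, CANONICAL docc-word edition, any `(t', t'')`** (the shape the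
downfold order seam consumes: uniform over the material box's `μ`-interval): canonical caps `e(1,s,Uᵢ,n) ≤ Rᵢ`
(`0 ≤ U₁ < U₂`, `0 ≤ n < 2`), docc words `A` (ceiling, torus-limit ground states at `U₁`) / `B` (floor, at `U₂`),
sourced floors `loᵢ ≤ E(s,Uᵢ,μ₂,h)` at the upper chemical potential (`h > 0`). Then every translation-invariant
`ε`-near-minimiser `σ` of source-free object M at `(1, t', t'', U, μ')` with `U ∈ [U₁,U₂]`, `μ' ∈ [μ₁,μ₂]` has
`e_P(σ) ≤ (min(R₁ + A(U − U₁), R₂ − B(U₂ − U)) − μ₁n − chord(lo₁,lo₂;U) + (32/π²)|t' − s| + (32/π²)|t''| + ε)/h`.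
[cite: KomaTasaki1994, §1] -/
theorem meanEnergy_pairSource_le_of_U_mu_cell_canonical_doccWords (s : ℝ) {U₁ U₂ : ℝ} (hU₁ : 0 ≤ U₁)
    (hlt : U₁ < U₂) {n : ℝ} (hn0 : 0 ≤ n) (hn2 : n < 2) {μ₁ μ₂ h : ℝ} (hh : 0 < h) {R₁ R₂ A B lo₁ lo₂ : ℝ}
    (hR₁ : energyDensityTT' 1 s U₁ n ≤ R₁) (hR₂ : energyDensityTT' 1 s U₂ n ≤ R₂)
    (hA : ∀ (ω : InfVolFermionState 2) (Ls : ℕ → ℕ) (ψ : ∀ L, Fock (Orb (FermionTorus 2 L))),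
      Tendsto Ls atTop atTop →
      (∀ j, IsGroundStateInSector (hubbardTorusTT' (Ls j) 1 s U₁) (rectN n (Ls j)) 0 (ψ (Ls j))) →
      (∀ j, star (ψ (Ls j)) ⬝ᵥ ψ (Ls j) = 1) → ω.IsTorusLimitOf ψ Ls →
      (ω.expect ({0} : Finset (Site 2))
          (nAt 0 (Finset.mem_singleton_self 0) 0 * nAt 0 (Finset.mem_singleton_self 0) 1)).re ≤ A)
    (hB : ∀ (ω : InfVolFermionState 2) (Ls : ℕ → ℕ) (ψ : ∀ L, Fock (Orb (FermionTorus 2 L))),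
      Tendsto Ls atTop atTop →
      (∀ j, IsGroundStateInSector (hubbardTorusTT' (Ls j) 1 s U₂) (rectN n (Ls j)) 0 (ψ (Ls j))) →
      (∀ j, star (ψ (Ls j)) ⬝ᵥ ψ (Ls j) = 1) → ω.IsTorusLimitOf ψ Ls →
      B ≤ (ω.expect ({0} : Finset (Site 2))
          (nAt 0 (Finset.mem_singleton_self 0) 0 * nAt 0 (Finset.mem_singleton_self 0) 1)).re)
    (hlo₁ : lo₁ ≤ dWaveSourceEnergyDensityTT' s U₁ μ₂ h) (hlo₂ : lo₂ ≤ dWaveSourceEnergyDensityTT' s U₂ μ₂ h)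
    {U μ' : ℝ} (h₁ : U₁ ≤ U) (h₂ : U ≤ U₂) (hμ₁ : μ₁ ≤ μ') (hμ₂ : μ' ≤ μ₂) (t' t'' : ℝ) {ε : ℝ}
    {σ : InfVolFermionState 2} (hσ : σ.IsTranslationInvariant)
    (hε : σ.meanEnergy (hubbardTT'T''SourcedInteraction 1 t' t'' U μ' dWaveFormFactor 0) 2 ≤
      (hubbardTT'T''SourcedInteraction 1 t' t'' U μ' dWaveFormFactor 0).tiGroundEnergyDensity 2 + ε) :
    σ.meanEnergy (pairSourceInteraction dWaveFormFactor) 1 ≤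
      (min (R₁ + A * (U - U₁)) (R₂ - B * (U₂ - U)) - μ₁ * n - (lo₁ + (lo₂ - lo₁) * (U - U₁) / (U₂ - U₁)) +
        32 / Real.pi ^ 2 * |t' - s| + 32 / Real.pi ^ 2 * |t''| + ε) / h := by
  have hcap := (dWaveSourceEnergyDensityTT'_antitone_mu s U 0 hμ₁).trans
    (dWaveSourceEnergyDensityTT'_U_interval_le_of_canonical_doccWords s hU₁ h₁ h₂ hn0 hn2 μ₁ 0 hR₁ hR₂ hA hB)
  have hfl := (dWaveSourceEnergyDensityTT'_ge_U_chord hlt h₁ h₂ hlo₁ hlo₂).trans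
    (dWaveSourceEnergyDensityTT'_antitone_mu s U h hμ₂)
  have htp := secant_dWaveSourceEnergyDensityTT'_sub_tp_le_kinematic U μ' 0 h s t'
  refine (meanEnergy_pairSource_le_secant_tpp t' U μ' t'' hh hσ hε).trans (div_le_div_of_nonneg_right ?_ hh.le)
  linarith

/-- **`ε = 0` (translation-invariant ground states of object M), canonical `U × μ` cell, UNIFORM BULGE form**:
every translation-invariant mean-energy minimiser of `H_M − μ'N` at `(1, t', t'', U, μ')`, `U ∈ [U₁,U₂]`,
`μ' ∈ [μ₁,μ₂]`, has
`e_P(σ) ≤ (max g₁ g₂ + (U₂ − U₁)·α⁺β⁺/(α⁺ + β⁺) + (32/π²)|t' − s| + (32/π²)|t''|)/h`, `gᵢ = Rᵢ − μ₁n − loᵢ`,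
`α = A − σ`, `β = σ − B`, `σ = (lo₂ − lo₁)/(U₂ − U₁)`. [cite: BratteliKishimotoRobinson1978, Thm. 2] -/
theorem meanEnergy_pairSource_le_bulge_of_U_mu_cell_canonical_doccWords_of_minimiser (s : ℝ) {U₁ U₂ : ℝ}
    (hU₁ : 0 ≤ U₁) (hlt : U₁ < U₂) {n : ℝ} (hn0 : 0 ≤ n) (hn2 : n < 2) {μ₁ μ₂ h : ℝ} (hh : 0 < h)
    {R₁ R₂ A B lo₁ lo₂ : ℝ} (hR₁ : energyDensityTT' 1 s U₁ n ≤ R₁) (hR₂ : energyDensityTT' 1 s U₂ n ≤ R₂)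
    (hA : ∀ (ω : InfVolFermionState 2) (Ls : ℕ → ℕ) (ψ : ∀ L, Fock (Orb (FermionTorus 2 L))),
      Tendsto Ls atTop atTop →
      (∀ j, IsGroundStateInSector (hubbardTorusTT' (Ls j) 1 s U₁) (rectN n (Ls j)) 0 (ψ (Ls j))) →
      (∀ j, star (ψ (Ls j)) ⬝ᵥ ψ (Ls j) = 1) → ω.IsTorusLimitOf ψ Ls →
      (ω.expect ({0} : Finset (Site 2))
          (nAt 0 (Finset.mem_singleton_self 0) 0 * nAt 0 (Finset.mem_singleton_self 0) 1)).re ≤ A)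
    (hB : ∀ (ω : InfVolFermionState 2) (Ls : ℕ → ℕ) (ψ : ∀ L, Fock (Orb (FermionTorus 2 L))),
      Tendsto Ls atTop atTop →
      (∀ j, IsGroundStateInSector (hubbardTorusTT' (Ls j) 1 s U₂) (rectN n (Ls j)) 0 (ψ (Ls j))) →
      (∀ j, star (ψ (Ls j)) ⬝ᵥ ψ (Ls j) = 1) → ω.IsTorusLimitOf ψ Ls →
      B ≤ (ω.expect ({0} : Finset (Site 2))
          (nAt 0 (Finset.mem_singleton_self 0) 0 * nAt 0 (Finset.mem_singleton_self 0) 1)).re)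
    (hlo₁ : lo₁ ≤ dWaveSourceEnergyDensityTT' s U₁ μ₂ h) (hlo₂ : lo₂ ≤ dWaveSourceEnergyDensityTT' s U₂ μ₂ h)
    {U μ' : ℝ} (h₁ : U₁ ≤ U) (h₂ : U ≤ U₂) (hμ₁ : μ₁ ≤ μ') (hμ₂ : μ' ≤ μ₂) (t' t'' : ℝ)
    {σ : InfVolFermionState 2}
    (hmin : σ.IsMeanEnergyMinimiser (hubbardTT'T''SourcedInteraction 1 t' t'' U μ' dWaveFormFactor 0) 2) :
    σ.meanEnergy (pairSourceInteraction dWaveFormFactor) 1 ≤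
      (max (R₁ - μ₁ * n - lo₁) (R₂ - μ₁ * n - lo₂) +
        (U₂ - U₁) * (max (A - (lo₂ - lo₁) / (U₂ - U₁)) 0 * max ((lo₂ - lo₁) / (U₂ - U₁) - B) 0) /
          (max (A - (lo₂ - lo₁) / (U₂ - U₁)) 0 + max ((lo₂ - lo₁) / (U₂ - U₁) - B) 0) +
        32 / Real.pi ^ 2 * |t' - s| + 32 / Real.pi ^ 2 * |t''|) / h := by
  have hk := meanEnergy_pairSource_le_of_U_mu_cell_canonical_doccWords (ε := 0) s hU₁ hlt hn0 hn2 hh hR₁ hR₂ hA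
    hB hlo₁ hlo₂ h₁ h₂ hμ₁ hμ₂ t' t'' hmin.1 (by rw [add_zero]; exact hmin.meanEnergy_eq.le)
  rw [add_zero] at hk
  refine hk.trans (div_le_div_of_nonneg_right ?_ hh.le)
  have hb := min_tangents_sub_chord_le_bulge (hi₁ := R₁ - μ₁ * n) (hi₂ := R₂ - μ₁ * n) (lo₁ := lo₁) (lo₂ := lo₂)
    (A := A) (B := B) hlt h₁ h₂
  have e : min (R₁ + A * (U - U₁)) (R₂ - B * (U₂ - U)) - μ₁ * n =
      min (R₁ - μ₁ * n + A * (U - U₁)) (R₂ - μ₁ * n - B * (U₂ - U)) := by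
    rw [← min_sub_sub_right]
    congr 1 <;> ring
  linarith [hb, e]

/-- **ABSENT(`< m₀`) FOR OBJECT M ON A WHOLE `U × μ` CELL** (canonical docc-word edition): if
`max g₁ g₂ + (U₂ − U₁)·α⁺β⁺/(α⁺ + β⁺) + (32/π²)|t' − s| + (32/π²)|t''| < h·m₀` then no translation-invariant ground
state of object M at `(1, t', t'', U, μ')` with `U ∈ [U₁,U₂]`, `μ' ∈ [μ₁,μ₂]` has `d`-wave pair amplitude `≥ m₀`.
[cite: KomaTasaki1994, §1] -/
theorem meanEnergy_pairSource_lt_on_U_mu_cell_canonical_doccWords_of_minimiser (s : ℝ) {U₁ U₂ : ℝ}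
    (hU₁ : 0 ≤ U₁) (hlt : U₁ < U₂) {n : ℝ} (hn0 : 0 ≤ n) (hn2 : n < 2) {μ₁ μ₂ h : ℝ} (hh : 0 < h)
    {R₁ R₂ A B lo₁ lo₂ m₀ : ℝ} (hR₁ : energyDensityTT' 1 s U₁ n ≤ R₁) (hR₂ : energyDensityTT' 1 s U₂ n ≤ R₂)
    (hA : ∀ (ω : InfVolFermionState 2) (Ls : ℕ → ℕ) (ψ : ∀ L, Fock (Orb (FermionTorus 2 L))),
      Tendsto Ls atTop atTop →
      (∀ j, IsGroundStateInSector (hubbardTorusTT' (Ls j) 1 s U₁) (rectN n (Ls j)) 0 (ψ (Ls j))) →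
      (∀ j, star (ψ (Ls j)) ⬝ᵥ ψ (Ls j) = 1) → ω.IsTorusLimitOf ψ Ls →
      (ω.expect ({0} : Finset (Site 2))
          (nAt 0 (Finset.mem_singleton_self 0) 0 * nAt 0 (Finset.mem_singleton_self 0) 1)).re ≤ A)
    (hB : ∀ (ω : InfVolFermionState 2) (Ls : ℕ → ℕ) (ψ : ∀ L, Fock (Orb (FermionTorus 2 L))),
      Tendsto Ls atTop atTop →
      (∀ j, IsGroundStateInSector (hubbardTorusTT' (Ls j) 1 s U₂) (rectN n (Ls j)) 0 (ψ (Ls j))) →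
      (∀ j, star (ψ (Ls j)) ⬝ᵥ ψ (Ls j) = 1) → ω.IsTorusLimitOf ψ Ls →
      B ≤ (ω.expect ({0} : Finset (Site 2))
          (nAt 0 (Finset.mem_singleton_self 0) 0 * nAt 0 (Finset.mem_singleton_self 0) 1)).re)
    (hlo₁ : lo₁ ≤ dWaveSourceEnergyDensityTT' s U₁ μ₂ h) (hlo₂ : lo₂ ≤ dWaveSourceEnergyDensityTT' s U₂ μ₂ h)
    {t' t'' : ℝ}
    (hnear : max (R₁ - μ₁ * n - lo₁) (R₂ - μ₁ * n - lo₂) +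
        (U₂ - U₁) * (max (A - (lo₂ - lo₁) / (U₂ - U₁)) 0 * max ((lo₂ - lo₁) / (U₂ - U₁) - B) 0) /
          (max (A - (lo₂ - lo₁) / (U₂ - U₁)) 0 + max ((lo₂ - lo₁) / (U₂ - U₁) - B) 0) +
        32 / Real.pi ^ 2 * |t' - s| + 32 / Real.pi ^ 2 * |t''| < h * m₀)
    {U μ' : ℝ} (h₁ : U₁ ≤ U) (h₂ : U ≤ U₂) (hμ₁ : μ₁ ≤ μ') (hμ₂ : μ' ≤ μ₂) {σ : InfVolFermionState 2}
    (hmin : σ.IsMeanEnergyMinimiser (hubbardTT'T''SourcedInteraction 1 t' t'' U μ' dWaveFormFactor 0) 2) :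
    σ.meanEnergy (pairSourceInteraction dWaveFormFactor) 1 < m₀ := by
  refine (meanEnergy_pairSource_le_bulge_of_U_mu_cell_canonical_doccWords_of_minimiser s hU₁ hlt hn0 hn2 hh hR₁
    hR₂ hA hB hlo₁ hlo₂ h₁ h₂ hμ₁ hμ₂ t' t'' hmin).trans_lt ?_
  rw [div_lt_iff₀ hh]
  linarith [hnear]

end PairAmplitude

/-! ### §7 By-product for the ENERGY word: the pointwise / sub-interval canonical window on a `U`-cell -/

section EnergyWindow

/-- **Chord floor in `U` for the canonical density, closed interval**: floors `Lᵢ ≤ e(t,s,Uᵢ,n)` (`0 ≤ U₁ < U₂`,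
`0 ≤ n < 2`) give `L₁ + (L₂ − L₁)(U − U₁)/(U₂ − U₁) ≤ e(t,s,U,n)` for every `U ∈ [U₁,U₂]` — `e` is concave in
`U ≥ 0` (`concaveOn_energyDensityTT'_U`; the tree's `energyDensityTT'_chord_le` is the open-interval form).
[cite: Griffiths1964, §II] -/
theorem energyDensityTT'_ge_U_chord (t s : ℝ) {U₁ U₂ U : ℝ} (hU₁ : 0 ≤ U₁) (hlt : U₁ < U₂) (h₁ : U₁ ≤ U)
    (h₂ : U ≤ U₂) {n : ℝ} (hn0 : 0 ≤ n) (hn2 : n < 2) {L₁ L₂ : ℝ} (hL₁ : L₁ ≤ energyDensityTT' t s U₁ n)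
    (hL₂ : L₂ ≤ energyDensityTT' t s U₂ n) :
    L₁ + (L₂ - L₁) * (U - U₁) / (U₂ - U₁) ≤ energyDensityTT' t s U n := by
  have hd : 0 < U₂ - U₁ := sub_pos.2 hlt
  have hp : 0 ≤ (U₂ - U) / (U₂ - U₁) := div_nonneg (sub_nonneg.2 h₂) hd.le
  have hq : 0 ≤ (U - U₁) / (U₂ - U₁) := div_nonneg (sub_nonneg.2 h₁) hd.le
  have hpq : (U₂ - U) / (U₂ - U₁) + (U - U₁) / (U₂ - U₁) = 1 := by
    rw [← add_div, show U₂ - U + (U - U₁) = U₂ - U₁ by ring, div_self hd.ne']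
  have hU : (U₂ - U) / (U₂ - U₁) * U₁ + (U - U₁) / (U₂ - U₁) * U₂ = U := by
    rw [div_mul_eq_mul_div, div_mul_eq_mul_div, ← add_div, div_eq_iff hd.ne']
    ring
  have hc := (concaveOn_energyDensityTT'_U t s hn0 hn2).2 (Set.mem_Ici.2 hU₁) (Set.mem_Ici.2 (hU₁.trans hlt.le))
    hp hq hpq
  simp only [smul_eq_mul] at hc
  rw [hU] at hc
  have e : L₁ + (L₂ - L₁) * (U - U₁) / (U₂ - U₁) =
      (U₂ - U) / (U₂ - U₁) * L₁ + (U - U₁) / (U₂ - U₁) * L₂ := by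
    field_simp
    ring
  rw [e]
  nlinarith [mul_le_mul_of_nonneg_left hL₁ hp, mul_le_mul_of_nonneg_left hL₂ hq]

/-- **THE POINTWISE ENERGY WINDOW ON A `U`-CELL from the two anchors and their docc rows**: floors `Lᵢ`, caps `Rᵢ`
at `U₁ < U₂` (`U₁ ≥ 0`, `0 ≤ n < 2`), a docc CEILING row `A` on the torus-limit ground states at `U₁` and a docc FLOOR
row `B` at `U₂` give, for every `U ∈ [U₁,U₂]`,
`e(t,s,U,n) ∈ [chord(L₁,L₂;U), min(R₁ + A(U − U₁), R₂ − B(U₂ − U))]` — versus the monotone cell word `[L₁, R₂]`.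
[cite: KomaTasaki1994, §1] -/
theorem energyDensityTT'_U_interval_mem_Icc_of_doccWords (t s : ℝ) {U₁ U₂ U : ℝ} (hU₁ : 0 ≤ U₁) (hlt : U₁ < U₂)
    (h₁ : U₁ ≤ U) (h₂ : U ≤ U₂) {n : ℝ} (hn0 : 0 ≤ n) (hn2 : n < 2) {L₁ L₂ R₁ R₂ A B : ℝ}
    (hL₁ : L₁ ≤ energyDensityTT' t s U₁ n) (hL₂ : L₂ ≤ energyDensityTT' t s U₂ n)
    (hR₁ : energyDensityTT' t s U₁ n ≤ R₁) (hR₂ : energyDensityTT' t s U₂ n ≤ R₂)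
    (hA : ∀ (ω : InfVolFermionState 2) (Ls : ℕ → ℕ) (ψ : ∀ L, Fock (Orb (FermionTorus 2 L))),
      Tendsto Ls atTop atTop →
      (∀ j, IsGroundStateInSector (hubbardTorusTT' (Ls j) t s U₁) (rectN n (Ls j)) 0 (ψ (Ls j))) →
      (∀ j, star (ψ (Ls j)) ⬝ᵥ ψ (Ls j) = 1) → ω.IsTorusLimitOf ψ Ls →
      (ω.expect ({0} : Finset (Site 2))
          (nAt 0 (Finset.mem_singleton_self 0) 0 * nAt 0 (Finset.mem_singleton_self 0) 1)).re ≤ A)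
    (hB : ∀ (ω : InfVolFermionState 2) (Ls : ℕ → ℕ) (ψ : ∀ L, Fock (Orb (FermionTorus 2 L))),
      Tendsto Ls atTop atTop →
      (∀ j, IsGroundStateInSector (hubbardTorusTT' (Ls j) t s U₂) (rectN n (Ls j)) 0 (ψ (Ls j))) →
      (∀ j, star (ψ (Ls j)) ⬝ᵥ ψ (Ls j) = 1) → ω.IsTorusLimitOf ψ Ls →
      B ≤ (ω.expect ({0} : Finset (Site 2))
          (nAt 0 (Finset.mem_singleton_self 0) 0 * nAt 0 (Finset.mem_singleton_self 0) 1)).re) :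
    energyDensityTT' t s U n ∈
      Set.Icc (L₁ + (L₂ - L₁) * (U - U₁) / (U₂ - U₁)) (min (R₁ + A * (U - U₁)) (R₂ - B * (U₂ - U))) :=
  ⟨energyDensityTT'_ge_U_chord t s hU₁ hlt h₁ h₂ hn0 hn2 hL₁ hL₂,
    energyDensityTT'_U_interval_le_min_tangents_of_doccWords t s hU₁ h₁ h₂ hn0 hn2 hR₁ hR₂ hA hB⟩

/-- An affine function on `[a,b]` is at least the smaller of its two end values. [folklore] -/
private theorem min_chord_ends_le_chord {L₁ L₂ U₁ U₂ a b U : ℝ} (ha : a ≤ U) (hb : U ≤ b) :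
    min (L₁ + (L₂ - L₁) * (a - U₁) / (U₂ - U₁)) (L₁ + (L₂ - L₁) * (b - U₁) / (U₂ - U₁)) ≤
      L₁ + (L₂ - L₁) * (U - U₁) / (U₂ - U₁) := by
  set k := (L₂ - L₁) / (U₂ - U₁) with hk
  have e : ∀ x : ℝ, L₁ + (L₂ - L₁) * (x - U₁) / (U₂ - U₁) = L₁ + k * (x - U₁) := by
    intro x
    rw [hk]
    ring
  rw [e a, e b, e U]
  rcases le_total 0 k with hk0 | hk0
  · exact (min_le_left _ _).trans (by nlinarith [mul_le_mul_of_nonneg_left ha hk0])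
  · exact (min_le_right _ _).trans (by nlinarith [mul_le_mul_of_nonpos_left hb hk0])

/-- **THE UNIFORM ENERGY WORD ON A QUERY SUB-INTERVAL `[a,b] ⊆ [U₁,U₂]`** (the resolution at which a surrogate reads a
query box inside a kernel cell): with the data of `energyDensityTT'_U_interval_mem_Icc_of_doccWords` and `0 ≤ A`,
`0 ≤ B` (docc rows are non-negative), every `U ∈ [a,b]` has
`e(t,s,U,n) ∈ [min(chord(a), chord(b)), min(R₁ + A(b − U₁), R₂ − B(U₂ − b))]` (the chord is affine, both tangents are
non-decreasing in `U`). [cite: KomaTasaki1994, §1] -/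
theorem energyDensityTT'_U_subinterval_mem_Icc_of_doccWords (t s : ℝ) {U₁ U₂ a b U : ℝ} (hU₁ : 0 ≤ U₁)
    (hlt : U₁ < U₂) (ha₁ : U₁ ≤ a) (ha : a ≤ U) (hb : U ≤ b) (hb₂ : b ≤ U₂) {n : ℝ} (hn0 : 0 ≤ n) (hn2 : n < 2)
    {L₁ L₂ R₁ R₂ A B : ℝ} (hA0 : 0 ≤ A) (hB0 : 0 ≤ B)
    (hL₁ : L₁ ≤ energyDensityTT' t s U₁ n) (hL₂ : L₂ ≤ energyDensityTT' t s U₂ n)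
    (hR₁ : energyDensityTT' t s U₁ n ≤ R₁) (hR₂ : energyDensityTT' t s U₂ n ≤ R₂)
    (hA : ∀ (ω : InfVolFermionState 2) (Ls : ℕ → ℕ) (ψ : ∀ L, Fock (Orb (FermionTorus 2 L))),
      Tendsto Ls atTop atTop →
      (∀ j, IsGroundStateInSector (hubbardTorusTT' (Ls j) t s U₁) (rectN n (Ls j)) 0 (ψ (Ls j))) →
      (∀ j, star (ψ (Ls j)) ⬝ᵥ ψ (Ls j) = 1) → ω.IsTorusLimitOf ψ Ls →
      (ω.expect ({0} : Finset (Site 2))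
          (nAt 0 (Finset.mem_singleton_self 0) 0 * nAt 0 (Finset.mem_singleton_self 0) 1)).re ≤ A)
    (hB : ∀ (ω : InfVolFermionState 2) (Ls : ℕ → ℕ) (ψ : ∀ L, Fock (Orb (FermionTorus 2 L))),
      Tendsto Ls atTop atTop →
      (∀ j, IsGroundStateInSector (hubbardTorusTT' (Ls j) t s U₂) (rectN n (Ls j)) 0 (ψ (Ls j))) →
      (∀ j, star (ψ (Ls j)) ⬝ᵥ ψ (Ls j) = 1) → ω.IsTorusLimitOf ψ Ls →
      B ≤ (ω.expect ({0} : Finset (Site 2))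
          (nAt 0 (Finset.mem_singleton_self 0) 0 * nAt 0 (Finset.mem_singleton_self 0) 1)).re) :
    energyDensityTT' t s U n ∈
      Set.Icc (min (L₁ + (L₂ - L₁) * (a - U₁) / (U₂ - U₁)) (L₁ + (L₂ - L₁) * (b - U₁) / (U₂ - U₁)))
        (min (R₁ + A * (b - U₁)) (R₂ - B * (U₂ - b))) := by
  obtain ⟨hlo, hhi⟩ := energyDensityTT'_U_interval_mem_Icc_of_doccWords t s hU₁ hlt (ha₁.trans ha) (hb.trans hb₂)
    hn0 hn2 hL₁ hL₂ hR₁ hR₂ hA hB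
  refine ⟨(min_chord_ends_le_chord ha hb).trans hlo, hhi.trans (le_min ?_ ?_)⟩
  · exact (min_le_left _ _).trans (by nlinarith [mul_le_mul_of_nonneg_left hb hA0])
  · exact (min_le_right _ _).trans (by nlinarith [mul_le_mul_of_nonneg_left hb hB0])

/-- **Kinematic sub-interval word** (no docc row; `A = n/2`, `B = 0`): every `U ∈ [a,b] ⊆ [U₁,U₂]` has
`e(t,s,U,n) ∈ [min(chord(a), chord(b)), min(R₁ + (n/2)(b − U₁), R₂)]`. [cite: Ruelle1969, §3.4] -/
theorem energyDensityTT'_U_subinterval_mem_Icc_kinematic (t s : ℝ) {U₁ U₂ a b U : ℝ} (hU₁ : 0 ≤ U₁)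
    (hlt : U₁ < U₂) (ha₁ : U₁ ≤ a) (ha : a ≤ U) (hb : U ≤ b) (hb₂ : b ≤ U₂) {n : ℝ} (hn0 : 0 ≤ n) (hn2 : n < 2)
    {L₁ L₂ R₁ R₂ : ℝ} (hL₁ : L₁ ≤ energyDensityTT' t s U₁ n) (hL₂ : L₂ ≤ energyDensityTT' t s U₂ n)
    (hR₁ : energyDensityTT' t s U₁ n ≤ R₁) (hR₂ : energyDensityTT' t s U₂ n ≤ R₂) :
    energyDensityTT' t s U n ∈
      Set.Icc (min (L₁ + (L₂ - L₁) * (a - U₁) / (U₂ - U₁)) (L₁ + (L₂ - L₁) * (b - U₁) / (U₂ - U₁)))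
        (min (R₁ + n / 2 * (b - U₁)) R₂) := by
  have h₁ : U₁ ≤ U := ha₁.trans ha
  have h₂ : U ≤ U₂ := hb.trans hb₂
  refine ⟨(min_chord_ends_le_chord ha hb).trans (energyDensityTT'_ge_U_chord t s hU₁ hlt h₁ h₂ hn0 hn2 hL₁ hL₂),
    (energyDensityTT'_U_interval_le_min_kinematic t s hU₁ h₁ h₂ hn0 hn2 hR₁ hR₂).trans (le_min ?_ (min_le_right _ _))⟩
  have hn : 0 ≤ n / 2 := by linarith
  exact (min_le_left _ _).trans (by nlinarith [mul_le_mul_of_nonneg_left hb hn])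

end EnergyWindow

/-! ### §8 Row-free chain edition: the neighbouring cells' secant slopes are admissible docc words -/

section Chain

/-- **The LEFT neighbour's secant slope is a docc CEILING word at `U₁`**: on `0 ≤ U₀ < U₁` (`0 ≤ n < 2`), a floor
`L₀ ≤ e(t,s,U₀,n)` and a cap `e(t,s,U₁,n) ≤ R₁` give `Re ω(n_{0↑}n_{0↓}) ≤ (R₁ − L₀)/(U₁ − U₀)` for EVERY torus
limit of unit sector ground states at `(t,s,U₁)` — the hypothesis `hA` of the docc-word theorems above, read from
the energy table (the tree's `IsTorusLimitOf.re_expect_docc_le_chord_of_groundState` in the certificate binder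
shape). [cite: KomaTasaki1994, §1] -/
theorem forall_isTorusLimitOf_docc_le_secant (t s : ℝ) {U₀ U₁ : ℝ} (hU₀ : 0 ≤ U₀) (hlt : U₀ < U₁) {n : ℝ}
    (hn0 : 0 ≤ n) (hn2 : n < 2) {L₀ R₁ : ℝ} (hL₀ : L₀ ≤ energyDensityTT' t s U₀ n)
    (hR₁ : energyDensityTT' t s U₁ n ≤ R₁) :
    ∀ (ω : InfVolFermionState 2) (Ls : ℕ → ℕ) (ψ : ∀ L, Fock (Orb (FermionTorus 2 L))),
      Tendsto Ls atTop atTop →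
      (∀ j, IsGroundStateInSector (hubbardTorusTT' (Ls j) t s U₁) (rectN n (Ls j)) 0 (ψ (Ls j))) →
      (∀ j, star (ψ (Ls j)) ⬝ᵥ ψ (Ls j) = 1) → ω.IsTorusLimitOf ψ Ls →
      (ω.expect ({0} : Finset (Site 2))
          (nAt 0 (Finset.mem_singleton_self 0) 0 * nAt 0 (Finset.mem_singleton_self 0) 1)).re ≤
        (R₁ - L₀) / (U₁ - U₀) :=
  fun _ _ _ hLs hψ h1 hω =>
    hω.re_expect_docc_le_chord_of_groundState t s (hU₀.trans hlt.le) hn0 hn2 hLs hψ h1 hR₁ hU₀ hlt hL₀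

/-- **The RIGHT neighbour's secant slope is a docc FLOOR word at `U₂`**: on `0 ≤ U₂ < U₃` (`0 ≤ n < 2`), a cap
`e(t,s,U₂,n) ≤ R₂` and a floor `L₃ ≤ e(t,s,U₃,n)` give `(L₃ − R₂)/(U₃ − U₂) ≤ Re ω(n_{0↑}n_{0↓})` for EVERY torus
limit of unit sector ground states at `(t,s,U₂)` — the hypothesis `hB` above (the tree's
`IsTorusLimitOf.chord_le_re_expect_docc_of_groundState`). [cite: KomaTasaki1994, §1] -/
theorem forall_isTorusLimitOf_secant_le_docc (t s : ℝ) {U₂ U₃ : ℝ} (hU₂ : 0 ≤ U₂) (hlt : U₂ < U₃) {n : ℝ}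
    (hn0 : 0 ≤ n) (hn2 : n < 2) {R₂ L₃ : ℝ} (hR₂ : energyDensityTT' t s U₂ n ≤ R₂)
    (hL₃ : L₃ ≤ energyDensityTT' t s U₃ n) :
    ∀ (ω : InfVolFermionState 2) (Ls : ℕ → ℕ) (ψ : ∀ L, Fock (Orb (FermionTorus 2 L))),
      Tendsto Ls atTop atTop →
      (∀ j, IsGroundStateInSector (hubbardTorusTT' (Ls j) t s U₂) (rectN n (Ls j)) 0 (ψ (Ls j))) →
      (∀ j, star (ψ (Ls j)) ⬝ᵥ ψ (Ls j) = 1) → ω.IsTorusLimitOf ψ Ls →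
      (L₃ - R₂) / (U₃ - U₂) ≤
        (ω.expect ({0} : Finset (Site 2))
          (nAt 0 (Finset.mem_singleton_self 0) 0 * nAt 0 (Finset.mem_singleton_self 0) 1)).re :=
  fun _ _ _ hLs hψ h1 hω => hω.chord_le_re_expect_docc_of_groundState t s hU₂ hn0 hn2 hLs hψ h1 hR₂ hlt hL₃

/-- **ROW-FREE POINTWISE ENERGY WINDOW ON AN INTERIOR CELL OF A `U`-CHAIN**: energy windows `[Lᵢ, Rᵢ]` at four
anchors `0 ≤ U₀ < U₁ < U₂ < U₃` (only `L₀, L₁, R₁, L₂, R₂, L₃` are used) give, for every `U ∈ [U₁,U₂]`,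
`e(t,s,U,n) ∈ [chord(L₁,L₂;U), min(R₁ + (U − U₁)(R₁ − L₀)/(U₁ − U₀), R₂ − (U₂ − U)(L₃ − R₂)/(U₃ − U₂))]`
— chord floor and the two secant EXTRAPOLATIONS (concavity), no docc row. [cite: Griffiths1964, §II] -/
theorem energyDensityTT'_U_interval_mem_Icc_of_chain (t s : ℝ) {U₀ U₁ U₂ U₃ U : ℝ} (hU₀ : 0 ≤ U₀)
    (h01 : U₀ < U₁) (h12 : U₁ < U₂) (h23 : U₂ < U₃) (h₁ : U₁ ≤ U) (h₂ : U ≤ U₂) {n : ℝ} (hn0 : 0 ≤ n)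
    (hn2 : n < 2) {L₀ L₁ R₁ L₂ R₂ L₃ : ℝ} (hL₀ : L₀ ≤ energyDensityTT' t s U₀ n)
    (hL₁ : L₁ ≤ energyDensityTT' t s U₁ n) (hR₁ : energyDensityTT' t s U₁ n ≤ R₁)
    (hL₂ : L₂ ≤ energyDensityTT' t s U₂ n) (hR₂ : energyDensityTT' t s U₂ n ≤ R₂)
    (hL₃ : L₃ ≤ energyDensityTT' t s U₃ n) :
    energyDensityTT' t s U n ∈
      Set.Icc (L₁ + (L₂ - L₁) * (U - U₁) / (U₂ - U₁))
        (min (R₁ + (R₁ - L₀) / (U₁ - U₀) * (U - U₁)) (R₂ - (L₃ - R₂) / (U₃ - U₂) * (U₂ - U))) :=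
  energyDensityTT'_U_interval_mem_Icc_of_doccWords t s (hU₀.trans h01.le) h12 h₁ h₂ hn0 hn2 hL₁ hL₂ hR₁ hR₂
    (forall_isTorusLimitOf_docc_le_secant t s hU₀ h01 hn0 hn2 hL₀ hR₁)
    (forall_isTorusLimitOf_secant_le_docc t s ((hU₀.trans h01.le).trans h12.le) h23 hn0 hn2 hR₂ hL₃)

/-- **ROW-FREE ORDER CEILING ON AN INTERIOR CELL OF A `U`-CHAIN** (canonical edition of §4 with the neighbours'
secant slopes as docc words): canonical energy rows `L₀ ≤ e(1,s,U₀,n)`, `e(1,s,U₁,n) ≤ R₁`, `e(1,s,U₂,n) ≤ R₂`,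
`L₃ ≤ e(1,s,U₃,n)` on `0 ≤ U₀ < U₁ < U₂ < U₃` and sourced floors `loᵢ ≤ E(s,Uᵢ,μ,h)` (`h > 0`) at `U₁, U₂` give,
for every `U ∈ [U₁,U₂]`,
`m⋆(s,U,μ) ≤ (min(R₁ + (U − U₁)(R₁ − L₀)/(U₁ − U₀), R₂ − (U₂ − U)(L₃ − R₂)/(U₃ − U₂)) − μn − chord(lo₁,lo₂;U))/(2h)`.
[cite: KomaTasaki1994, §1] -/
theorem dWaveOrderParameterTT'_U_interval_le_of_chain (s : ℝ) {U₀ U₁ U₂ U₃ : ℝ} (hU₀ : 0 ≤ U₀)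
    (h01 : U₀ < U₁) (h12 : U₁ < U₂) (h23 : U₂ < U₃) {n : ℝ} (hn0 : 0 ≤ n) (hn2 : n < 2) {μ h : ℝ}
    (hh : 0 < h) {L₀ R₁ R₂ L₃ lo₁ lo₂ : ℝ} (hL₀ : L₀ ≤ energyDensityTT' 1 s U₀ n)
    (hR₁ : energyDensityTT' 1 s U₁ n ≤ R₁) (hR₂ : energyDensityTT' 1 s U₂ n ≤ R₂)
    (hL₃ : L₃ ≤ energyDensityTT' 1 s U₃ n) (hlo₁ : lo₁ ≤ dWaveSourceEnergyDensityTT' s U₁ μ h)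
    (hlo₂ : lo₂ ≤ dWaveSourceEnergyDensityTT' s U₂ μ h) {U : ℝ} (h₁ : U₁ ≤ U) (h₂ : U ≤ U₂) :
    dWaveOrderParameterTT' s U μ ≤
      (min (R₁ + (R₁ - L₀) / (U₁ - U₀) * (U - U₁)) (R₂ - (L₃ - R₂) / (U₃ - U₂) * (U₂ - U)) - μ * n -
        (lo₁ + (lo₂ - lo₁) * (U - U₁) / (U₂ - U₁))) / (2 * h) :=
  dWaveOrderParameterTT'_U_interval_le_of_canonical_doccWords s (hU₀.trans h01.le) h12 hn0 hn2 hh hR₁ hR₂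
    (forall_isTorusLimitOf_docc_le_secant 1 s hU₀ h01 hn0 hn2 hL₀ hR₁)
    (forall_isTorusLimitOf_secant_le_docc 1 s ((hU₀.trans h01.le).trans h12.le) h23 hn0 hn2 hR₂ hL₃) hlo₁ hlo₂ h₁ h₂

/-- **ROW-FREE PAIR-AMPLITUDE CEILING ON AN INTERIOR `U × μ` CELL OF A CHAIN** (§6 canonical cell edition with
the neighbours' secant slopes as docc words; floors `loᵢ` certified at `μ₂`): every translation-invariant
`ε`-near-minimiser `σ` of source-free object M at `(1, t', t'', U, μ')`, `U ∈ [U₁,U₂]`, `μ' ∈ [μ₁,μ₂]`, has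
`e_P(σ) ≤ (min(R₁ + (U − U₁)(R₁ − L₀)/(U₁ − U₀), R₂ − (U₂ − U)(L₃ − R₂)/(U₃ − U₂)) − μ₁n − chord(lo₁,lo₂;U)
  + (32/π²)|t' − s| + (32/π²)|t''| + ε)/h`. [cite: KomaTasaki1994, §1] -/
theorem meanEnergy_pairSource_le_of_U_mu_cell_of_chain (s : ℝ) {U₀ U₁ U₂ U₃ : ℝ} (hU₀ : 0 ≤ U₀)
    (h01 : U₀ < U₁) (h12 : U₁ < U₂) (h23 : U₂ < U₃) {n : ℝ} (hn0 : 0 ≤ n) (hn2 : n < 2) {μ₁ μ₂ h : ℝ}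
    (hh : 0 < h) {L₀ R₁ R₂ L₃ lo₁ lo₂ : ℝ} (hL₀ : L₀ ≤ energyDensityTT' 1 s U₀ n)
    (hR₁ : energyDensityTT' 1 s U₁ n ≤ R₁) (hR₂ : energyDensityTT' 1 s U₂ n ≤ R₂)
    (hL₃ : L₃ ≤ energyDensityTT' 1 s U₃ n) (hlo₁ : lo₁ ≤ dWaveSourceEnergyDensityTT' s U₁ μ₂ h)
    (hlo₂ : lo₂ ≤ dWaveSourceEnergyDensityTT' s U₂ μ₂ h) {U μ' : ℝ} (h₁ : U₁ ≤ U) (h₂ : U ≤ U₂)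
    (hμ₁ : μ₁ ≤ μ') (hμ₂ : μ' ≤ μ₂) (t' t'' : ℝ) {ε : ℝ} {σ : InfVolFermionState 2}
    (hσ : σ.IsTranslationInvariant)
    (hε : σ.meanEnergy (hubbardTT'T''SourcedInteraction 1 t' t'' U μ' dWaveFormFactor 0) 2 ≤
      (hubbardTT'T''SourcedInteraction 1 t' t'' U μ' dWaveFormFactor 0).tiGroundEnergyDensity 2 + ε) :
    σ.meanEnergy (pairSourceInteraction dWaveFormFactor) 1 ≤
      (min (R₁ + (R₁ - L₀) / (U₁ - U₀) * (U - U₁)) (R₂ - (L₃ - R₂) / (U₃ - U₂) * (U₂ - U)) - μ₁ * n -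
          (lo₁ + (lo₂ - lo₁) * (U - U₁) / (U₂ - U₁)) +
        32 / Real.pi ^ 2 * |t' - s| + 32 / Real.pi ^ 2 * |t''| + ε) / h :=
  meanEnergy_pairSource_le_of_U_mu_cell_canonical_doccWords s (hU₀.trans h01.le) h12 hn0 hn2 hh hR₁ hR₂
    (forall_isTorusLimitOf_docc_le_secant 1 s hU₀ h01 hn0 hn2 hL₀ hR₁)
    (forall_isTorusLimitOf_secant_le_docc 1 s ((hU₀.trans h01.le).trans h12.le) h23 hn0 hn2 hR₂ hL₃) hlo₁ hlo₂ h₁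
    h₂ hμ₁ hμ₂ t' t'' hσ hε

end Chain

end Literature.MathematicalPhysics.QuantumLattice

end
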